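/-
Copyright: lit-balaban Phase-2 proof seat p29 (gen 29).  Statement-level skeleton of a published paper; no proof claims beyond what the
kernel checks below.
-/
import Literature.MathematicalPhysics.QuantumFieldTheory.BalabanImbrieJaffe1984to88.BIJ88NeumannPropagatorSmallFieldRegion
import Literature.MathematicalPhysics.QuantumFieldTheory.BalabanImbrieJaffe1984to88.BIJ88LocDeriv230ZetaPiFlatTorus
import Literature.MathematicalPhysics.QuantumFieldTheory.Balaban1983to89.T4TreeGaugeTransform

/-!
# `BalabanImbrieJaffe1984to88.BIJ88LocDeriv230SmallFieldTorus` — T. Bałaban, J. Imbrie, A. Jaffe, *Effective action and cluster properties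
of the abelian Higgs model*, Commun. Math. Phys. **114** (1988) 257–315 [BalabanImbrieJaffe1988], Sect. 2 p. 263 [PDF 7], the sentence after
(2.33): *"Bounds analogous to (2.30), (2.31) hold for covariant derivatives and Hölder derivatives of G_{k,loc}(u) of order less than two"* —
**THE COVARIANT-DERIVATIVE MEMBER AND THE HÖLDER MEMBER OF ORDER `θ ≤ 1` OF (2.30) AT NON-FLAT SMALL FIELDS `u`, KERNEL FORM, FOR THE
PRINTED LOCALIZATION DATA** (the torus cubes `{□_α}`, the weights `λ_α` of (2.27) and the cut-off `ζ″` of (2.29) of gen 26's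
`BIJ88LocWeights227Torus`; the flat-background members are gen 27/28's `BIJ88LocDeriv230FlatTorus`, `BIJ88LocHolder230FlatTorus`,
`BIJ88LocDeriv230ZetaPiFlatTorus`, `BIJ88LocDerivHolder230FlatTorus`).

statement-level skeleton of published theorems with citation tags; proofs where landed; nothing here is a claim about the Yang–Mills mass gap

PDF held: `paper:balaban1988-cmp114-bij-abelian-higgs-effective-action` (journal page = PDF page + 256); p. 263 [PDF 7] re-read this session on
the page render `run/shared/lean/pub/lit-balaban/lit-balaban-p31/renders/original-p007-x2.png`; [6] = T. Bałaban, *Regularity and decay of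
lattice Green's functions*, Commun. Math. Phys. **89** (1983) 571–597 [Balaban1983RegularityDecay], p. 573 re-read from the text layer of
`paper:balaban1983-cmp89-regularity-decay` (`lit read … --pages 3-4`).

CITATION HEADER (lean-in-tree rule).  Part of the lit-balaban TYPED SKELETON (HOME `run/shared/lean/pub/lit-balaban/`), PHASE-2 proof seat
p29 gen 29 (unit `lit-balaban-p29-g29`; TAKING line HOME/STATUS.md 2026-08-23T00:15:08Z; free-target protocol G.5-34(d) — own lineage, the
gen-28 HANDOFF *"NEXT FREE TARGETS"*, made possible at non-flat `u` by p34 gen 16's `BIJ88NeumannPropagatorSmallFieldRegion` (p344577 §4, v1.1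
p345166 §7)).  Rows **C2.Claim@263** (*"covariant derivatives and Hölder derivatives of G_{k,loc}(u)"*; owner r18; head = p08's abstract
hence-step `BIJ88HolderDecay230`, unchanged) and **C2.Eq2.30** / **C2.Eq2.28** (the value kernel member for the data at non-flat `u`).  Kind:
theorems only (no definition, no `Prop`-valued fact; p34's / p31's / p13's / r18's / gen 26–28's / T4's declarations used BY NAME).

THE PRINTED TEXT (verbatim, p. 263).  *"Define G̃_k(u; x₁, x₂) = Σ_α λ_αG_k(□_α, u; x₁, x₂) (2.27) as a convex combination of Neumann
propagators. … We then put G_{k,loc}(u; x₁, x₂) = ζ″_k(x₁, x₂)G̃_k(u; x₁, x₂), (2.28) where ζ″_k(x₁, x₂) is a smooth function of x₁ − x₂,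
ζ″_k(x₁, x₂) = 0, if |x₁ − x₂| ≧ (1/(4L)) r(e_{k−1}); 1, if |x₁ − x₂| ≦ (1/(8L)) r(e_{k−1}). (2.29) The boundary conditions are always at a
distance O(r(e_k)) from x₁, x₂, so a straightforward application of the random walk expansion of [6] shows that |(G_{k,loc}(u)f)(x)| ≦
ce^{−c dist(suppt f,x)}‖f‖_∞, (2.30) … We assume that u is smooth in the □_α's entering the sum in (2.27) … Bounds analogous to (2.30), (2.31)
hold for covariant derivatives and Hölder derivatives of G_{k,loc}(u) of order less than two."*  [6] p. 573: *"Finally for an arbitrary pair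
of points x, x′ ∈ ηZ^d, let us denote by Γ_{x,x′} a shortest contour connecting these points. … |x − x′|^{−α}|U(A(Γ_{x,x′}))(D^η_{A,μ}G_k(Ω,
A)f)(x′) − (D^η_{A,μ}G_k(Ω, A)f)(x)| ≤ c₀exp(−δ₀ dist({x, x′}, supp f))‖f‖_∞ (1.9) … |(D^η_{A,μ}G_k(Ω,A)f)(x)|, |(G_k(Ω,A)f)(x)| ≤
c₀exp(−δ₀dist(x, supp f))‖f‖_∞ (1.10)"*.

THE SMALLNESS OF THE FIELD (print's *"u is smooth in the □_α's entering the sum in (2.27)"*) is p34's bondwise form, here LOCALIZED to the box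
`Ω₀` containing all the cubes: `|u_b − 1| ≤ T` for the bonds of `Ω₀` inside one `k`-block, `|u(Γ^{(k)}_{x_k,x}) − 1| ≤ δ` for `x ∈ Ω₀`
(`holCK`), `2(L^k−1)L^k·d·T² + 2δ² ≤ 1/2`; every cube `□_α ⊆ Ω₀` is a union of `k`-blocks (p31's `isBlockUnion_cubeT`) and inherits it
(`smallField_cubeFam`), so p34's region theorems apply cube by cube.

THE MECHANISM (ours, declared; print says only *"analogous"*).  (§1) gen 27's bond identity read on the kernel column `y`:
`D_u(G_{k,loc}(u)(·,y))(b) = Σ_α w_α(b₊,y)·D_u(G_k(□_α,u)(·,y))(b) + ε⁻¹Σ_α (w_α(b₊,y) − w_α(b₋,y))·G_k(□_α,u; b₋, y)`, `w_α = ζ″λ_α`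
(`covD_gLocT_col`).  (§3) The first sum is p34's covariant-derivative member `decay_covD_kernel_smallField_region` on the cubes ACTIVE at
`b₊` — both bond ends lie in every active cube by gen 26's row hypothesis (ii) once `R > 1` — weighted by `Σ_α|w_α(b₊,y)| ≤ 1` (NO
multiplicity); the second is p34's kernel bound `decay_kernel_smallField_region` on each `□_α` times the one-step modulus `K/(R₀−R₁) +
3π(d+1)/(2s)` of the row weights (gen 27/28's `exists_abs_cutoff_sub_le`, `abs_weight_shift_sub_le`) over the `≤ 2m` labels active at `b₋` or
`b₊`, `m = (⌊(L^k − 1 + R₀)/s⌋ + 3)^{d+1}` (gen 26's block count), times `ε⁻¹(L^kε)² = (L^kε)L^k`; the rate is `min` of p34's two rates, one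
lattice step costing a factor `e^{t₀}`.  (§2, §4) GAUGE-COVARIANT TELESCOPING AT NON-FLAT `u` along a bond chain `Γ = (s_0, …, s_n)`:
`‖u(Γ)ψ(s_n) − ψ(s_0)‖ ≤ ε·Σ_{m<n}‖(D_uψ)(c_m)‖` (`u(Γ)` = T4's ordered holonomy `chainHol`, `|u| = 1`; `norm_transport_sub_le_sum_covD`), so
for an ADMISSIBLE contour (a chain of `n ≤ (d+1)|x₁ − x₂|_T` bonds whose sites lie in `Ω₀` at chart depth `≥ R₀` within `|x₁ − x₂|_T` of
`x₁`) and `|x₁ − x₂|_T ≤ L^k` the weight `(L^k/|x₁ − x₂|_T)^θ ≤ L^k/|x₁ − x₂|_T` (`θ ≤ 1`) against `n·ε` leaves `(d+1)L^kε` times the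
derivative member; far pairs by two value members (`decay_gLocT_smallField_kernel_loc`, p34's §4 cube by cube under the localized smallness).
(§6) Admissible contours EXIST between deep points at torus distance `≤ R₀`: the chart staircase (`exists_staircase`, one coordinate step at
a time inside the coordinate hull; `exists_admissible_contour`), [6]'s *"shortest contour"*.

WHAT IS PROVED (theorems only; 0 `sorry`; standard axioms).
* §1 `covD_gLocT_col` (the kernel-column bond identity; any data, any `u`).
* §2 **`norm_transport_sub_le_sum_covD`** (telescoping of the transported difference along any bond chain at any `U(1)` field).
* §3 `smallField_cubeFam`, **`decay_gLocT_smallField_kernel_loc`** (`‖G_{k,loc}(u;x,y)‖ ≤ c₀(L^kε)²e^{−t₀|x−y|_T/L^k}` for the data under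
  the LOCALIZED smallness, all `x, y`), **`deriv230_smallField_of_lipschitz`** — for every `K ≥ 0` THERE EXIST `t₀, C > 0` depending on
  `(d, a, K)` only such that for every volume (`P.d = d+1`), every `1 ≤ k ≤ m + K`, every no-wrap box `Ω₀ = c·L^k + Π_i[0, L^k·M₀_i)` shorter
  than the torus leaving a torus gap `≥ R`, cube spacing `s ≥ 1`, half-width `W ≥ 2s/3 + R₀/2 + R`, radii `1 < R`, `0 ≤ R₁ < R₀`, every real
  cut-off `ζ″` with `|ζ″| ≤ 1`, `ζ″ = 0` beyond `R₀`, one-step modulus `K/(R₀ − R₁)`, every `U(1)` field bondwise small inside `Ω₀`, every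
  bond `⟨x, x+e_μ⟩` with both ends in `Ω₀` at chart depth `≥ R₀`, and every column `y`:
  `‖ε⁻¹(u(b)G_{k,loc}(u; x+e_μ, y) − G_{k,loc}(u; x, y))‖ ≤ (L^kε)·C·(1 + m·L^k((R₀ − R₁)⁻¹ + s⁻¹))·e^{−t₀|x − y|_T/L^k}`.
* §4 **`holder230_smallField_of_lipschitz`** — same data, every `0 ≤ θ ≤ 1`, every admissible contour `Γ` from `x₁` to `x₂`, every `y` at
  sup-torus distance `≥ D ≥ 0` from both:
  `(L^k/|x₁ − x₂|_T)^θ·‖u(Γ)G_{k,loc}(u; x₂, y) − G_{k,loc}(u; x₁, y)‖ ≤ (L^kε)²·C·(1 + m·L^k((R₀ − R₁)⁻¹ + s⁻¹))·e^{−t₀D/L^k}`.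
* §5 `cutoff_hyps`, **`deriv230_smallField_cwt`** / **`holder230_smallField_cwt`** (p13's cut-off `σ((R₀ − |x − y|_T)/(R₀ − R₁))` of record,
  constants from `(d, a)` and gen 27's universal `K_σ`), **`deriv230_smallField_zetaPi`** / **`holder230_smallField_zetaPi`** (r18's smooth
  product cut-off `ζ^Π(R₁, R₀)`, the tree's universal bound `C_σ` on `|σ′|`).
* §6 `exists_staircase`, **`exists_admissible_contour`** (deep points `x₁, x₂ ∈ Ω₀` with `|x₁ − x₂|_T ≤ R₀` are joined by an admissible
  contour of `≤ (d+1)|x₁ − x₂|_T` steps).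
* §7 **`exists_contour_holder230_smallField_cwt`** — [6]'s form: for near deep pairs THERE IS a shortest contour `Γ_{x₁,x₂}` along which the
  Hölder bound of §5 holds.
* §8 (v1.1, APPEND-ONLY) NON-VACUITY: **`deriv230_smallField_cwt_instance`** — every hypothesis of `deriv230_smallField_cwt` met at once on
  gen 26's `Setup` torus `ℤ/162` (`d = 1`, `L = 3`; `k = 1`, `Ω₀ = [0,12)`, `s = 1`, `W = 4`, `R = 2`, `R₁ = 0`, `R₀ = 1`, the trivial field
  `u = 1` with `T = δ = 0` by p31's `holCK_flat`, the bond `⟨5, 6⟩`), so the bound holds there for every column `y`.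
HONEST SCOPE.  (i) KERNEL FORM ONLY (the column `y` of `G_{k,loc}(u)`): p34's inputs are kernel bounds of size `c₀(L^kε)²` without the
short-distance gain, so the printed `‖f‖_∞` operator forms do NOT follow `k`-uniformly by a row sum (p34's HONEST SCOPE (i); its announced
files 2/3 — the free Neumann resolvent and the tilted row bound on regions — would give them).  (ii) ORDERS `1` AND `θ ≤ 1` ONLY: the order
`1 + θ` member (Hölder quotients of `D_uG_{k,loc}`) at non-flat `u` needs [6] (1.9) for the cube propagators at non-flat `u`, which the tree
does not have (gen 28's `BIJ88LocDerivHolder230FlatTorus` is flat).  (iii) (2.30)-ANALOGUES ONLY: no (2.31)-analogue at non-flat `u` (it needs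
the closeness of `G_k(□_α,u)` to `G_k(Ω,u)` at non-flat `u`, not in the tree).  (iv) The smallness hypothesis is p34's bondwise form INSIDE
`Ω₀` (a gauge in which `u` is near `1` there); gauge-transformed statements are not restated.  (v) Geometry as gen 27: no-wrap box `Ω₀`
shorter than the torus with torus gap `≥ R > 1`, both bond ends (all contour sites) at chart depth `≥ R₀`; the admissible-contour hypothesis of
§4 is discharged by §6 for pairs at torus distance `≤ R₀` (far pairs need no contour geometry, but the statement keeps one shape).  (vi)
Constants explicit, not optimized; `K_σ`, `C_σ` non-explicit (compactness); `j = 0`; `1 ≤ k ≤ m + K`.  Imports: p34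
`BIJ88NeumannPropagatorSmallFieldRegion` (→ p27 `BIJ85ScalarPropagatorSupDecay`, p31, p33), gen 28 `BIJ88LocDeriv230ZetaPiFlatTorus` (→ gen 27,
gen 26, p31, p13, r18), T4 `T4TreeGaugeTransform` (`chainHol`, `chainStep`, `Joins`).  Literature + Mathlib only.  Unit `lit-balaban-p29`
(literature-prover-lit-balaban-p29-g29-0), 2026-08-23; v1 = p347004 (ACCEPTED aa9d622e13ba), v1.1 = APPEND-ONLY §8 (same unit and session;
everything before §8 byte-identical to v1 except this docstring).  NOT summit progress.
-/

open scoped BigOperators Matrix ComplexConjugate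
open Finset Matrix

namespace Literature.MathematicalPhysics.QuantumFieldTheory.BalabanImbrieJaffe1984to88.BIJ88LocDeriv230SmallFieldTorus

open Literature.MathematicalPhysics.QuantumFieldTheory.Balaban1983to89
open BIJ88Sect3Statements (U1 toC cfg covD starB mem_starB norm_toC toC_mul toC_inv toC_one)
open BIJ85BlockAveragesTorus BIJ85BlockAveragesTorusK
open BIJ88NeumannPropagator227Torus (gBox)
open BIJ88DeltaLoc234Torus (gLocT gTilde gLocT_apply gTilde_apply)
open T4TreeGaugeFixing (Joins)
open T4TreeGaugeTransform (chainHol chainStep chainHol_succ chainHol_zero)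

noncomputable section

variable {P : Params} {j : ℕ}

/-! ## §1 The bond identity on the kernel column: the covariant derivative of `G_{k,loc}(u)(·, y)` cube by cube -/

/-- **`D_u(G_{k,loc}(u)(·,y))(b) = Σ_α w_α(b₊,y)·D_u(G_k(□_α,u)(·,y))(b) + c′·Σ_α (w_α(b₊,y) − w_α(b₋,y))·G_k(□_α,u; b₋, y)`**, `w_α = ζ″λ_α`
— gen 27's `covD_gLocT_apply` read on the kernel column `y` (p31's `gLocT_apply`/`gTilde_apply` at both endpoints, regrouped); any
background, any data. [cite: BalabanImbrieJaffe1988, (2.28) p.263] -/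
theorem covD_gLocT_col (c' : ℝ) (u : PBond P j → ℂ) (a' c'' : ℝ) (U : GaugeField P j U1) (k : ℕ) {ι : Type*} [Fintype ι]
    (cube : ι → Finset (Balaban1983to89.Site P j)) (lam : ι → Balaban1983to89.Site P j → Balaban1983to89.Site P j → ℝ)
    (ζ'' : Balaban1983to89.Site P j → Balaban1983to89.Site P j → ℝ) (y : Balaban1983to89.Site P j) (b : PBond P j) :
    covD c' u (fun z => gLocT a' c'' U k cube lam ζ'' z y) b =
      (∑ α, (((ζ'' b.tgt y * lam α b.tgt y : ℝ) : ℂ) * covD c' u (fun z => gBox a' c'' U k (cube α) z y) b)) +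
      ∑ α, ((c' : ℂ) * ((((ζ'' b.tgt y * lam α b.tgt y - ζ'' b.src y * lam α b.src y : ℝ) : ℂ)) *
        gBox a' c'' U k (cube α) b.src y)) := by
  rw [← Finset.sum_add_distrib]
  simp only [covD]
  rw [gLocT_apply, gLocT_apply, gTilde_apply, gTilde_apply, Finset.mul_sum, Finset.mul_sum, Finset.mul_sum, ← Finset.sum_sub_distrib,
    Finset.mul_sum]
  refine Finset.sum_congr rfl fun α _ => ?_
  push_cast
  ring

/-! ## §2 Gauge-covariant telescoping at a general `U(1)` field along a bond chain -/

/-- **TELESCOPING THE TRANSPORTED DIFFERENCE ALONG A BOND CHAIN AT ANY `U(1)` FIELD** ([6] (1.9)'s `U(A(Γ_{x,x′}))φ(x′) − φ(x)`; here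
`u(Γ) =` T4's ordered holonomy `chainHol` of the chain `(s_0, …, s_n)` whose `m`-th bond `c_m` joins `s_m` to `s_{m+1}` in either
orientation): `‖u(Γ)ψ(s_n) − ψ(s_0)‖ ≤ |c′|⁻¹·Σ_{m<n}‖(D^{c′}_uψ)(c_m)‖` — one bond at a time, `u(c_m)ψ(c_m₊) − ψ(c_m₋) = c′⁻¹(D_uψ)(c_m)` for a
forward bond and `ū(c_m)ψ(c_m₋) − ψ(c_m₊) = −ū(c_m)c′⁻¹(D_uψ)(c_m)` for a backward one, `|u| = 1`. [cite: Balaban1983RegularityDecay, (1.9) p.573] -/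
theorem norm_transport_sub_le_sum_covD (U : GaugeField P j U1) {c' : ℝ} (hc : c' ≠ 0) (ψ : Balaban1983to89.Site P j → ℂ)
    (s : ℕ → Balaban1983to89.Site P j) (c : ℕ → PBond P j) :
    ∀ n : ℕ, (∀ m < n, Joins (c m) (s m) (s (m + 1))) →
      ‖toC (chainHol s c U n) * ψ (s n) - ψ (s 0)‖ ≤ |c'|⁻¹ * ∑ m ∈ Finset.range n, ‖covD c' (cfg U) ψ (c m)‖ := by
  intro n
  induction n with
  | zero =>
      intro _
      simp [chainHol_zero, toC_one]
  | succ n ih =>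
      intro hJ
      have hJn : ∀ m < n, Joins (c m) (s m) (s (m + 1)) := fun m hm => hJ m (Nat.lt_succ_of_lt hm)
      have hstep : ‖toC (chainStep s c U n) * ψ (s (n + 1)) - ψ (s n)‖ = |c'|⁻¹ * ‖covD c' (cfg U) ψ (c n)‖ := by
        have hcC : (c' : ℂ) ≠ 0 := by exact_mod_cast hc
        have key : ∀ w : ℂ, ‖w‖ = |c'|⁻¹ * ‖(c' : ℂ) * w‖ := fun w => by
          rw [norm_mul, Complex.norm_real, Real.norm_eq_abs, ← mul_assoc, inv_mul_cancel₀ (abs_ne_zero.2 hc), one_mul]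
        unfold chainStep
        rcases hJ n (Nat.lt_succ_self n) with ⟨h1, h2⟩ | ⟨h1, h2⟩
        · rw [if_pos h1]
          simp only [covD, cfg]
          rw [key, h2, h1]
        · by_cases hsrc : (c n).src = s n
          · rw [if_pos hsrc]
            simp only [covD, cfg]
            rw [key]
            -- here src = s n and src = s (n+1), tgt = s n
            rw [h2, ← h1, hsrc]
          · rw [if_neg hsrc, toC_inv]
            simp only [covD, cfg]
            have hu : ‖toC (U (c n))‖ = 1 := norm_toC _
            have hne : toC (U (c n)) ≠ 0 := fun h => by simp [h] at hu
            have e : (starRingEnd ℂ) (toC (U (c n))) * ψ (s (n + 1)) - ψ (s n) =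
                -((starRingEnd ℂ) (toC (U (c n))) * (toC (U (c n)) * ψ (c n).tgt - ψ (c n).src)) := by
              rw [h1, h2]
              have h3 : (starRingEnd ℂ) (toC (U (c n))) * toC (U (c n)) = 1 := by
                rw [← Complex.normSq_eq_conj_mul_self, ← Complex.sq_norm, hu]; norm_num
              calc (starRingEnd ℂ) (toC (U (c n))) * ψ (s (n + 1)) - ψ (s n)
                  = (starRingEnd ℂ) (toC (U (c n))) * ψ (s (n + 1)) - ((starRingEnd ℂ) (toC (U (c n))) * toC (U (c n))) * ψ (s n) := by
                    rw [h3, one_mul]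
                _ = _ := by ring
            rw [e, norm_neg, norm_mul, RCLike.norm_conj, hu, one_mul, key]
      calc ‖toC (chainHol s c U (n + 1)) * ψ (s (n + 1)) - ψ (s 0)‖
          = ‖toC (chainHol s c U n) * (toC (chainStep s c U n) * ψ (s (n + 1)) - ψ (s n)) +
              (toC (chainHol s c U n) * ψ (s n) - ψ (s 0))‖ := by
            rw [chainHol_succ, toC_mul]; ring_nf
        _ ≤ ‖toC (chainHol s c U n) * (toC (chainStep s c U n) * ψ (s (n + 1)) - ψ (s n))‖ +
              ‖toC (chainHol s c U n) * ψ (s n) - ψ (s 0)‖ := norm_add_le _ _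
        _ ≤ |c'|⁻¹ * ‖covD c' (cfg U) ψ (c n)‖ + |c'|⁻¹ * ∑ m ∈ Finset.range n, ‖covD c' (cfg U) ψ (c m)‖ := by
            refine add_le_add ?_ (ih hJn)
            rw [norm_mul, norm_toC, one_mul, hstep]
        _ = |c'|⁻¹ * ∑ m ∈ Finset.range (n + 1), ‖covD c' (cfg U) ψ (c m)‖ := by
            rw [Finset.sum_range_succ]; ring


/-! ## §3 The covariant-derivative member of (2.30) at non-flat small fields, KERNEL FORM, for the torus cubes and weights of record -/

section Deriv

open BIJ88NeumannPropagatorFlatDecayCube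
open BIJ88NeumannPropagatorFlatClose231 (abs_lam_le_one)
open BIJ88NeumannPropagatorSmallFieldRegion (decay_kernel_smallField_region decay_covD_kernel_smallField_region)
open BIJ88LocWeights227Torus
open BIJ88LocDeriv230FlatTorus (exists_abs_cutoff_sub_le T_shift_le_one abs_T_shift_sub_le)
open BIJ88LocDeriv230ZetaPiFlatTorus (abs_weight_shift_sub_le)
open BIJ88NeumannNoZeroModesTorus (IsBlockUnion)
open B3Bound323ZeroTorus (T_eq_supDist)

variable {d : ℕ}

/-- kernel: the label of a fine site over its own `k`-block site. [cite: BalabanImbrieJaffe1985, (2.4) p.302, dictionary] -/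
private theorem mem_blockK_blkIter {k : ℕ} (x : Balaban1983to89.Site P 0) : x ∈ blockK k (blkIter k x) :=
  mem_blockK.2 rfl

/-- kernel: one lattice step costs a factor `e^{t}` in the decay: `exp (-(t₁ * D₁ / n)) ≤ exp t * exp (-(t * (n⁻¹ * D)))` for
`0 < t ≤ t₁`, `1 ≤ n`, `0 ≤ D₁`, `D - 1 ≤ D₁`. [folklore] -/
private theorem exp_shift_le {t t₁ n D D₁ : ℝ} (ht : 0 < t) (ht₁ : t ≤ t₁) (hn : 1 ≤ n) (hD₁ : 0 ≤ D₁) (hD : D - 1 ≤ D₁) :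
    Real.exp (-(t₁ * D₁ / n)) ≤ Real.exp t * Real.exp (-(t * (n⁻¹ * D))) := by
  rw [← Real.exp_add]
  refine Real.exp_le_exp.2 ?_
  have hn0 : 0 < n := by linarith
  have h1 : t * D₁ / n ≤ t₁ * D₁ / n := div_le_div_of_nonneg_right (mul_le_mul_of_nonneg_right ht₁ hD₁) hn0.le
  have h2 : t * (n⁻¹ * D) ≤ t * D₁ / n + t := by
    have : t * (n⁻¹ * D) = t * D / n := by field_simp
    rw [this]
    have h3 : t * D / n ≤ t * (D₁ + 1) / n := div_le_div_of_nonneg_right (by nlinarith) hn0.le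
    have h4 : t * (D₁ + 1) / n = t * D₁ / n + t / n := by rw [mul_add, mul_one, add_div]
    have h5 : t / n ≤ t := div_le_self ht.le hn
    linarith
  linarith

/-- kernel: `exp (-(t₂ * D / n)) ≤ exp (-(t * (n⁻¹ * D)))` for `t ≤ t₂`, `0 ≤ D`, `0 < n`. [folklore] -/
private theorem exp_rate_le {t t₂ n D : ℝ} (ht₂ : t ≤ t₂) (hn : 0 < n) (hD : 0 ≤ D) :
    Real.exp (-(t₂ * D / n)) ≤ Real.exp (-(t * (n⁻¹ * D))) := by
  refine Real.exp_le_exp.2 ?_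
  have : t * (n⁻¹ * D) = t * D / n := by field_simp
  rw [this]
  have := div_le_div_of_nonneg_right (mul_le_mul_of_nonneg_right ht₂ hD) hn.le
  linarith

/-- **Each torus cube `□_α` of (2.27) is a union of `k`-blocks inside `Ω₀`, so a field bondwise small inside `Ω₀` is bondwise small
inside every `□_α`** (p34's hypothesis cube by cube: gen 26's `cubeFam_fits`, p31's `isBlockUnion_cubeT`, `cubeOf_subset`).
[cite: BalabanImbrieJaffe1988, (2.27) p.263] -/
theorem smallField_cubeFam (hPd : P.d = d + 1) {k : ℕ} (hk : k ≤ P.m + P.K) {c M0 : Fin (d + 1) → ℕ} (hM0 : ∀ i, 1 ≤ M0 i)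
    (hfit0 : ∀ i, c i * P.L ^ k + P.L ^ k * M0 i ≤ P.sitesPerDir 0) (hN0 : ∀ i, P.L ^ k * M0 i < P.sitesPerDir 0) {s W : ℕ}
    {U : GaugeField P 0 U1} {Tu δ : ℝ}
    (hInt : ∀ b ∈ starB (cubeT hPd (P.L ^ k) c fun i => P.L ^ k * M0 i), blkIter k b.src = blkIter k b.tgt → ‖toC (U b) - 1‖ ≤ Tu)
    (hTree : ∀ x ∈ (cubeT hPd (P.L ^ k) c fun i => P.L ^ k * M0 i), ‖holCK U k x - 1‖ ≤ δ) (α : ↥(labels (P.L ^ k) M0 s)) :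
    IsBlockUnion k (cubeFam hPd (P.L ^ k) c M0 s W α) ∧
      (∀ b ∈ starB (cubeFam hPd (P.L ^ k) c M0 s W α), blkIter k b.src = blkIter k b.tgt → ‖toC (U b) - 1‖ ≤ Tu) ∧
      (∀ z ∈ cubeFam hPd (P.L ^ k) c M0 s W α, ‖holCK U k z - 1‖ ≤ δ) := by
  have hsub : cubeFam hPd (P.L ^ k) c M0 s W α ⊆ cubeT hPd (P.L ^ k) c (fun i => P.L ^ k * M0 i) := cubeOf_subset α.1
  obtain ⟨c', M', hM', hfit', hN', hcα⟩ := cubeFam_fits (hPd := hPd) (s := s) (W := W) hM0 hfit0 hN0 α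
  refine ⟨?_, fun b hb hbb => hInt b ?_ hbb, fun z hz => hTree z (hsub hz)⟩
  · rw [hcα]; exact isBlockUnion_cubeT hPd hk rfl hfit'
  · rw [mem_starB] at hb ⊢; exact ⟨hsub hb.1, hsub hb.2⟩

/-- **KERNEL DECAY OF (2.28)/(2.30) `G_{k,loc}(u)` AT NON-FLAT SMALL FIELDS FOR THE TORUS CUBES AND WEIGHTS OF RECORD**, the smallness
hypothesis LOCALIZED to `Ω₀` (p34's `decay_gLocT_smallField_kernel` takes it on the whole torus; here `decay_kernel_smallField_region` cube by
cube, `Σ_α|λ_α| ≤ 1`, `|ζ″| ≤ 1`): THERE EXIST `t₀, c₀ > 0` depending on `(d, a)` only such that for every volume, `1 ≤ k ≤ m + K`, every no-wrap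
box `Ω₀` shorter than the torus, every real cut-off `|ζ″| ≤ 1`, every `U(1)` field bondwise small inside `Ω₀` and ALL `x, y`:
`‖G_{k,loc}(u; x, y)‖ ≤ c₀(L^kε)²e^{−t₀|x − y|_T/L^k}`. [cite: BalabanImbrieJaffe1988, (2.30) p.263] -/
theorem decay_gLocT_smallField_kernel_loc (d : ℕ) {a : ℝ} (ha : 0 < a) :
    ∃ t₀ c₀ : ℝ, 0 < t₀ ∧ 0 < c₀ ∧ ∀ (P : Params) (hPd : P.d = d + 1),
      ∀ k : ℕ, 1 ≤ k → k ≤ P.m + P.K → ∀ (c M0 : Fin (d + 1) → ℕ), (∀ i, 1 ≤ M0 i) →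
        (∀ i, c i * P.L ^ k + P.L ^ k * M0 i ≤ P.sitesPerDir 0) → (∀ i, P.L ^ k * M0 i < P.sitesPerDir 0) →
      ∀ (s W : ℕ) (ζ : Balaban1983to89.Site P 0 → Balaban1983to89.Site P 0 → ℝ), (∀ x y, |ζ x y| ≤ 1) →
      ∀ (U : GaugeField P 0 U1) (Tu δ : ℝ),
        (∀ b ∈ starB (cubeT hPd (P.L ^ k) c fun i => P.L ^ k * M0 i), blkIter k b.src = blkIter k b.tgt → ‖toC (U b) - 1‖ ≤ Tu) →
        (∀ x ∈ (cubeT hPd (P.L ^ k) c fun i => P.L ^ k * M0 i), ‖holCK U k x - 1‖ ≤ δ) →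
        2 * (((P.L : ℝ) ^ k - 1) * (P.L : ℝ) ^ k) * P.d * Tu ^ 2 + 2 * δ ^ 2 ≤ 1 / 2 →
      ∀ x y : Balaban1983to89.Site P 0,
        ‖gLocT (B1RG242Torus.α P a k * (P.L : ℝ) ^ (k * P.d)) P.eps⁻¹ U k (cubeFam hPd (P.L ^ k) c M0 s W)
            (lamFam hPd (P.L ^ k) c M0 s) ζ x y‖ ≤
          c₀ * P.spacing k ^ 2 * Real.exp (-(t₀ * (((P.L : ℝ) ^ k)⁻¹ * B5Ineq137Torus.T P 0 x y))) := by
  obtain ⟨t₀, c₀, ht₀, hc₀, H⟩ := decay_kernel_smallField_region (d + 1) ha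
  refine ⟨t₀, c₀, ht₀, hc₀, ?_⟩
  intro P hPd k hk1 hk c M0 hM0 hfit0 hN0 s W ζ hζ U Tu δ hInt hTree hsmall x y
  have hcube := smallField_cubeFam hPd hk hM0 hfit0 hN0 (s := s) (W := W) hInt hTree
  set A : ℝ := B1RG242Torus.α P a k * (P.L : ℝ) ^ (k * P.d) with hAdef
  set E : ℝ := c₀ * P.spacing k ^ 2 * Real.exp (-(t₀ * (((P.L : ℝ) ^ k)⁻¹ * B5Ineq137Torus.T P 0 x y))) with hEdef
  have hE : 0 ≤ E := by positivity
  have hB : ∀ α, ‖gBox A P.eps⁻¹ U k (cubeFam hPd (P.L ^ k) c M0 s W α) x y‖ ≤ E := fun α => by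
    obtain ⟨hBU, hIntα, hTreeα⟩ := hcube α
    refine (H P hPd k hk1 hk _ hBU U Tu δ hIntα hTreeα hsmall x y).trans (le_of_eq ?_)
    rw [hEdef, T_eq_supDist P x y]
    congr 2; ring
  rw [gLocT_apply, gTilde_apply, norm_mul, Complex.norm_real, Real.norm_eq_abs]
  calc |ζ x y| * ‖∑ α, (lamFam hPd (P.L ^ k) c M0 s α x y : ℂ) * gBox A P.eps⁻¹ U k (cubeFam hPd (P.L ^ k) c M0 s W α) x y‖
      ≤ 1 * ∑ α, ‖(lamFam hPd (P.L ^ k) c M0 s α x y : ℂ) * gBox A P.eps⁻¹ U k (cubeFam hPd (P.L ^ k) c M0 s W α) x y‖ :=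
        mul_le_mul (hζ x y) (norm_sum_le _ _) (norm_nonneg _) zero_le_one
    _ ≤ ∑ α, |lamFam hPd (P.L ^ k) c M0 s α x y| * E := by
        rw [one_mul]
        refine Finset.sum_le_sum fun α _ => ?_
        rw [norm_mul, Complex.norm_real, Real.norm_eq_abs]
        exact mul_le_mul_of_nonneg_left (hB α) (abs_nonneg _)
    _ = (∑ α, |lamFam hPd (P.L ^ k) c M0 s α x y|) * E := by rw [Finset.sum_mul]
    _ ≤ 1 * E := mul_le_mul_of_nonneg_right (sum_abs_lamT_le_one hfit0 x y) hE
    _ = E := one_mul _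

/-- **THE COVARIANT-DERIVATIVE MEMBER OF (2.30) AT NON-FLAT SMALL FIELDS, KERNEL FORM, FOR THE TORUS CUBES AND WEIGHTS OF RECORD AND ANY
LIPSCHITZ CUT-OFF** (p. 263: *"We assume that u is smooth in the □_α's entering the sum in (2.27) … Bounds analogous to (2.30), (2.31) hold
for covariant derivatives and Hölder derivatives of G_{k,loc}(u) of order less than two"*, the (2.30)-analogue for the covariant derivative,
read on the kernel).  For every Lipschitz modulus parameter `K ≥ 0` THERE EXIST `t₀, C > 0` depending on `(d, a, K)` only such that for every
volume (`P.d = d+1`), every `1 ≤ k ≤ K_P`, every no-wrap box `Ω₀ = c·L^k + Π_i[0, L^k·M₀_i)` shorter than the torus leaving a torus gap `≥ R`,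
cube spacing `s ≥ 1`, half-width `W ≥ 2s/3 + R₀/2 + R`, radii `1 < R`, `0 ≤ R₁ < R₀`, EVERY real cut-off `ζ″` with `|ζ″| ≤ 1`, `ζ″(x,y) = 0`
for `|x − y|_T ≥ R₀` and `|ζ″(x + e_ν, y) − ζ″(x, y)| ≤ K/(R₀ − R₁)`, every `U(1)` field `u` BONDWISE SMALL INSIDE `Ω₀` (`|u_b − 1| ≤ T` on the
bonds of `Ω₀` inside one `k`-block, `|u(Γ^{(k)}_{x_k,x}) − 1| ≤ δ` on `Ω₀`, `2(L^k−1)L^k·d·T² + 2δ² ≤ 1/2` — p34's hypothesis, cube by cube),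
every bond `⟨x, x+e_μ⟩` with both endpoints in `Ω₀` at chart depth `≥ R₀`, and every column `y`:
`‖ε⁻¹(u(b)G_{k,loc}(u; x + e_μ, y) − G_{k,loc}(u; x, y))‖ ≤ (L^kε)·C·(1 + m·L^k·((R₀ − R₁)⁻¹ + s⁻¹))·e^{−t₀|x − y|_T/L^k}`,
`m = (⌊(L^k − 1 + R₀)/s⌋ + 3)^{d+1}` — first sum of `covD_gLocT_col`: p34's covariant-derivative member `decay_covD_kernel_smallField_region` on the
cubes ACTIVE at `x + e_μ` (both bond ends inside, gen 26's row hypothesis (ii)) weighted by `Σ_α|ζ″λ_α| ≤ 1`; second sum: p34's kernel bound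
`decay_kernel_smallField_region` on `□_α ⊆ Ω₀` times the one-step modulus `K/(R₀−R₁) + 3π(d+1)/(2s)` of the row weights over the `≤ 2m`
active labels, times `ε⁻¹(L^kε)² = (L^kε)L^k`. [cite: BalabanImbrieJaffe1988, (2.30) p.263] -/
theorem deriv230_smallField_of_lipschitz (d : ℕ) {a : ℝ} (ha : 0 < a) {K : ℝ} (hK0 : 0 ≤ K) :
    ∃ t₀ C : ℝ, 0 < t₀ ∧ 0 < C ∧ ∀ (P : Params) (hPd : P.d = d + 1),
      ∀ k : ℕ, 1 ≤ k → k ≤ P.m + P.K → ∀ (c M0 : Fin (d + 1) → ℕ), (∀ i, 1 ≤ M0 i) →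
        (∀ i, c i * P.L ^ k + P.L ^ k * M0 i ≤ P.sitesPerDir 0) → (∀ i, P.L ^ k * M0 i < P.sitesPerDir 0) →
      ∀ (s W : ℕ), 1 ≤ s → ∀ (R R₀ R₁ : ℝ), 1 < R → 0 ≤ R₁ → R₁ < R₀ → 2 * (s : ℝ) / 3 + R₀ / 2 + R ≤ W →
        (∀ i, ((P.L ^ k * M0 i : ℕ) : ℝ) + R ≤ P.sitesPerDir 0) →
      ∀ (ζ : Balaban1983to89.Site P 0 → Balaban1983to89.Site P 0 → ℝ), (∀ x y, |ζ x y| ≤ 1) →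
        (∀ x y, R₀ ≤ B5Ineq137Torus.T P 0 x y → ζ x y = 0) →
        (∀ (x y : Balaban1983to89.Site P 0) (ν : Fin P.d), |ζ (x.shift ν) y - ζ x y| ≤ K / (R₀ - R₁)) →
      ∀ (U : GaugeField P 0 U1) (Tu δ : ℝ),
        (∀ b ∈ starB (cubeT hPd (P.L ^ k) c fun i => P.L ^ k * M0 i), blkIter k b.src = blkIter k b.tgt → ‖toC (U b) - 1‖ ≤ Tu) →
        (∀ x ∈ (cubeT hPd (P.L ^ k) c fun i => P.L ^ k * M0 i), ‖holCK U k x - 1‖ ≤ δ) →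
        2 * (((P.L : ℝ) ^ k - 1) * (P.L : ℝ) ^ k) * P.d * Tu ^ 2 + 2 * δ ^ 2 ≤ 1 / 2 →
      ∀ (x : Balaban1983to89.Site P 0) (μ : Fin P.d),
        x ∈ (cubeT hPd (P.L ^ k) c fun i => P.L ^ k * M0 i) →
        (∀ i, R₀ ≤ (boxCoord hPd (P.L ^ k) c x i : ℝ) ∧ (boxCoord hPd (P.L ^ k) c x i : ℝ) + R₀ ≤ (P.L ^ k * M0 i : ℕ) - 1) →
        x.shift μ ∈ (cubeT hPd (P.L ^ k) c fun i => P.L ^ k * M0 i) →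
        (∀ i, R₀ ≤ (boxCoord hPd (P.L ^ k) c (x.shift μ) i : ℝ) ∧
          (boxCoord hPd (P.L ^ k) c (x.shift μ) i : ℝ) + R₀ ≤ (P.L ^ k * M0 i : ℕ) - 1) →
      ∀ y : Balaban1983to89.Site P 0,
        ‖covD P.eps⁻¹ (cfg U) (fun z =>
            gLocT (B1RG242Torus.α P a k * (P.L : ℝ) ^ (k * P.d)) P.eps⁻¹ U k (cubeFam hPd (P.L ^ k) c M0 s W)
              (lamFam hPd (P.L ^ k) c M0 s) ζ z y) ⟨x, μ⟩‖ ≤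
          P.spacing k * (C * (1 + (⌊(((P.L : ℝ) ^ k) - 1 + R₀) / s⌋₊ + 3) ^ (d + 1) *
            ((P.L : ℝ) ^ k * ((R₀ - R₁)⁻¹ + (s : ℝ)⁻¹))) * Real.exp (-(t₀ * (((P.L : ℝ) ^ k)⁻¹ * B5Ineq137Torus.T P 0 x y)))) := by
  obtain ⟨t₁, c₁, ht₁, hc₁, H1⟩ := decay_covD_kernel_smallField_region (d + 1) ha
  obtain ⟨t₂, c₂, ht₂, hc₂, H2⟩ := decay_kernel_smallField_region (d + 1) ha
  -- the constants: rate `t = min t₁ t₂`, prefactor `max (c₁e^t) (2c₂·max(K, 3π(d+1)/2))`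
  set t : ℝ := min t₁ t₂ with htdef
  have ht0 : 0 < t := lt_min ht₁ ht₂
  have htt₁ : t ≤ t₁ := min_le_left _ _
  have htt₂ : t ≤ t₂ := min_le_right _ _
  set Λ₀ : ℝ := max K (3 * Real.pi * (d + 1 : ℕ) / 2) with hΛ₀def
  have hΛ₀0 : 0 ≤ Λ₀ := hK0.trans (le_max_left _ _)
  refine ⟨t, max (c₁ * Real.exp t) (2 * c₂ * Λ₀ + 1), ht0, lt_max_of_lt_left (by positivity), ?_⟩
  intro P hPd k hk1 hkmK c M0 hM0 hfit0 hN0 s W hs R R₀ R₁ hR hR₁ hR10 hW hgap ζ hζabs hζ0 hζlip U Tu δ hInt hTree hsmall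
    x μ hx hdeep hxe hdeepe y
  set C := max (c₁ * Real.exp t) (2 * c₂ * Λ₀ + 1) with hCdef
  have hC1 : c₁ * Real.exp t ≤ C := le_max_left _ _
  have hC2 : 2 * c₂ * Λ₀ + 1 ≤ C := le_max_right _ _
  have hC0 : 0 ≤ C := le_trans (by positivity) hC1
  have hn : 1 ≤ P.L ^ k := Nat.one_le_pow _ _ P.L_pos
  have hk : 0 + k ≤ P.m + P.K := by omega
  have hR0 : 0 ≤ R := zero_le_one.trans hR.le
  have hR₀ : 0 ≤ R₀ := hR₁.trans hR10.le
  have hs0 : 0 < s := hs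
  have hsr : (0 : ℝ) < s := by exact_mod_cast hs0
  have hgap' : 0 < R₀ - R₁ := sub_pos.2 hR10
  have hLpos : (0 : ℝ) < P.L := P.cast_L_pos
  have hLk : (0 : ℝ) < (P.L : ℝ) ^ k := pow_pos hLpos _
  have hLk1 : (1 : ℝ) ≤ (P.L : ℝ) ^ k := one_le_pow₀ (B1RG242Torus.one_lt_cast_L P).le
  have hε : 0 < ((P.L : ℝ) ^ k)⁻¹ := inv_pos.mpr hLk
  have hsp0 : 0 < P.spacing k := P.spacing_pos k
  have heps : 0 < P.eps := P.eps_pos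
  -- abbreviations
  set Ω₀ : Finset (Balaban1983to89.Site P 0) := cubeT hPd (P.L ^ k) c fun i => P.L ^ k * M0 i with hΩ₀def
  set A : ℝ := B1RG242Torus.α P a k * (P.L : ℝ) ^ (k * P.d) with hAdef
  set x' := x.shift μ with hx'def
  set m : ℝ := ((⌊(((P.L : ℝ) ^ k) - 1 + R₀) / s⌋₊ : ℝ) + 3) ^ (d + 1) with hmdef
  have hm0 : 0 ≤ m := by rw [hmdef]; positivity
  set E : ℝ := Real.exp (-(t * (((P.L : ℝ) ^ k)⁻¹ * B5Ineq137Torus.T P 0 x y))) with hEdef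
  have hE0 : 0 < E := Real.exp_pos _
  have hTxy : B5Ineq137Torus.T P 0 x y = (LatticeFieldCalculus.supDist x y : ℝ) := T_eq_supDist P x y
  have hD0 : 0 ≤ B5Ineq137Torus.T P 0 x y := B5Ineq137Torus.T_nonneg P 0 x y
  -- each torus cube is a union of `k`-blocks inside `Ω₀`, where the field is small
  have hcube := smallField_cubeFam hPd hkmK hM0 hfit0 hN0 (s := s) (W := W) hInt hTree
  -- the kernel-column identity
  rw [covD_gLocT_col]
  -- the active-label sets of the two endpoints
  set Sx : Finset ↥(labels (P.L ^ k) M0 s) := (activeLabels hPd (P.L ^ k) c s R₀ (blkIter k x)).subtype fun α => α ∈ labels (P.L ^ k) M0 s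
    with hSxdef
  set Sx' : Finset ↥(labels (P.L ^ k) M0 s) := (activeLabels hPd (P.L ^ k) c s R₀ (blkIter k x')).subtype fun α => α ∈ labels (P.L ^ k) M0 s
    with hSx'def
  have hcardx : (Sx.card : ℝ) ≤ m := by
    have h1 := card_subtype_activeLabels_le (hPd := hPd) (c := c) (M0 := M0) hn hs0 hR₀ (blkIter k x)
    have e : (((P.L ^ k : ℕ) : ℕ) : ℝ) = (P.L : ℝ) ^ k := by push_cast; rfl
    rw [hSxdef, hmdef]; rw [e] at h1; exact h1
  have hcardx' : (Sx'.card : ℝ) ≤ m := by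
    have h1 := card_subtype_activeLabels_le (hPd := hPd) (c := c) (M0 := M0) hn hs0 hR₀ (blkIter k x')
    have e : (((P.L ^ k : ℕ) : ℕ) : ℝ) = (P.L : ℝ) ^ k := by push_cast; rfl
    rw [hSx'def, hmdef]; rw [e] at h1; exact h1
  have hSx : ∀ (α : ↥(labels (P.L ^ k) M0 s)) (y : Balaban1983to89.Site P 0),
      ζ x y * lamFam hPd (P.L ^ k) c M0 s α x y ≠ 0 → α ∈ Sx := by
    intro α y hne
    rw [hSxdef, Finset.mem_subtype]
    exact mem_activeLabels_of_ne_zero_of_deep hk hs0 hfit0 hζ0 (mem_blockK_blkIter x) hdeep hne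
  have hSx' : ∀ (α : ↥(labels (P.L ^ k) M0 s)) (y : Balaban1983to89.Site P 0),
      ζ x' y * lamFam hPd (P.L ^ k) c M0 s α x' y ≠ 0 → α ∈ Sx' := by
    intro α y hne
    rw [hSx'def, Finset.mem_subtype]
    exact mem_activeLabels_of_ne_zero_of_deep hk hs0 hfit0 hζ0 (mem_blockK_blkIter x') hdeepe hne
  -- TERM 1: p34's covariant-derivative member for the cubes active at `x'`, weighted by `|ζ″λ_α|`
  set B₁ : ℝ := c₁ * Real.exp t * P.spacing k * E with hB₁def
  have hB₁0 : 0 ≤ B₁ := by positivity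
  have hterm1 : ∀ α, ‖(((ζ x' y * lamFam hPd (P.L ^ k) c M0 s α x' y : ℝ) : ℂ)) *
      covD P.eps⁻¹ (cfg U) (fun z => gBox A P.eps⁻¹ U k (cubeFam hPd (P.L ^ k) c M0 s W α) z y) ⟨x, μ⟩‖ ≤
        |ζ x' y * lamFam hPd (P.L ^ k) c M0 s α x' y| * B₁ := by
    intro α
    by_cases hne : ζ x' y * lamFam hPd (P.L ^ k) c M0 s α x' y = 0
    · rw [hne]; simp
    rw [norm_mul, Complex.norm_real, Real.norm_eq_abs]
    refine mul_le_mul_of_nonneg_left ?_ (abs_nonneg _)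
    -- both endpoints lie in the active cube
    obtain ⟨hx'α, -, hfar⟩ := rowHyp_ii hPd hn hs0 hfit0 hR0 hgap hW hζ0 hxe hdeepe α y hne
    have hxα : x ∈ cubeFam hPd (P.L ^ k) c M0 s W α := by
      by_contra hnot
      have h1 := (hfar x hx hnot).1
      have h2 : B5Ineq137Torus.T P 0 x' x ≤ 1 := by
        rw [B5Ineq137Torus.T_symm]; exact T_shift_le_one x μ
      linarith
    have hbmem : (⟨x, μ⟩ : PBond P 0) ∈ starB (cubeFam hPd (P.L ^ k) c M0 s W α) := by
      rw [mem_starB]; exact ⟨hxα, hx'α⟩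
    obtain ⟨hBU, hIntα, hTreeα⟩ := hcube α
    refine (H1 P hPd k hk1 hkmK _ hBU U Tu δ hIntα hTreeα hsmall ⟨x, μ⟩ hbmem y).trans ?_
    -- `c₁·(L^kε)·e^{-t₁|y - x'|/L^k} ≤ c₁e^t·(L^kε)·E`
    have hdist : B5Ineq137Torus.T P 0 x y - 1 ≤ (LatticeFieldCalculus.supDist y (x.shift μ) : ℝ) := by
      rw [← T_eq_supDist P, B5Ineq137Torus.T_symm P 0 y (x.shift μ)]
      have := abs_T_shift_sub_le x y μ
      rw [abs_le] at this; linarith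
    have hexp := exp_shift_le ht0 htt₁ hLk1 (Nat.cast_nonneg _) hdist
    show c₁ * P.spacing k * Real.exp (-(t₁ * (LatticeFieldCalculus.supDist y (x.shift μ) : ℝ) / (P.L : ℝ) ^ k)) ≤ B₁
    calc c₁ * P.spacing k * Real.exp (-(t₁ * (LatticeFieldCalculus.supDist y (x.shift μ) : ℝ) / (P.L : ℝ) ^ k))
        ≤ c₁ * P.spacing k * (Real.exp t * E) := mul_le_mul_of_nonneg_left hexp (by positivity)
      _ = B₁ := by rw [hB₁def]; ring
  have hsumw : ∑ α, |ζ x' y * lamFam hPd (P.L ^ k) c M0 s α x' y| ≤ 1 := by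
    simp_rw [abs_mul, ← Finset.mul_sum]
    calc |ζ x' y| * ∑ α, |lamFam hPd (P.L ^ k) c M0 s α x' y| ≤ 1 * 1 :=
          mul_le_mul (hζabs x' y) (sum_abs_lamT_le_one hfit0 x' y) (Finset.sum_nonneg fun α _ => abs_nonneg _) zero_le_one
      _ = 1 := one_mul _
  have hsum1 : ‖∑ α, (((ζ x' y * lamFam hPd (P.L ^ k) c M0 s α x' y : ℝ) : ℂ)) *
      covD P.eps⁻¹ (cfg U) (fun z => gBox A P.eps⁻¹ U k (cubeFam hPd (P.L ^ k) c M0 s W α) z y) ⟨x, μ⟩‖ ≤ B₁ := by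
    refine (norm_sum_le _ _).trans ?_
    refine (Finset.sum_le_sum fun α _ => hterm1 α).trans ?_
    rw [← Finset.sum_mul]
    calc (∑ α, |ζ x' y * lamFam hPd (P.L ^ k) c M0 s α x' y|) * B₁ ≤ 1 * B₁ := mul_le_mul_of_nonneg_right hsumw hB₁0
      _ = B₁ := one_mul _
  -- TERM 2: p34's kernel bound on the cubes active at `x` or `x'`, times the one-step modulus of the weights
  set Λ : ℝ := K / (R₀ - R₁) + 3 * Real.pi * (d + 1 : ℕ) / (2 * s) with hΛdef
  have hΛ0 : 0 ≤ Λ := by rw [hΛdef]; positivity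
  set B₂ : ℝ := c₂ * P.spacing k ^ 2 * E with hB₂def
  have hB₂0 : 0 ≤ B₂ := by positivity
  have hterm2 : ∀ α, ‖((P.eps⁻¹ : ℝ) : ℂ) *
      ((((ζ x' y * lamFam hPd (P.L ^ k) c M0 s α x' y - ζ x y * lamFam hPd (P.L ^ k) c M0 s α x y : ℝ)) : ℂ) *
        gBox A P.eps⁻¹ U k (cubeFam hPd (P.L ^ k) c M0 s W α) x y)‖ ≤ P.eps⁻¹ * (Λ * B₂) := by
    intro α
    rw [norm_mul, Complex.norm_real, Real.norm_eq_abs, abs_of_pos (inv_pos.mpr heps), norm_mul, Complex.norm_real, Real.norm_eq_abs]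
    refine mul_le_mul_of_nonneg_left ?_ (inv_pos.mpr heps).le
    have hdw : |ζ x' y * lamFam hPd (P.L ^ k) c M0 s α x' y - ζ x y * lamFam hPd (P.L ^ k) c M0 s α x y| ≤ Λ :=
      abs_weight_shift_sub_le hPd hs0 hfit0 hN0 (div_nonneg hK0 hgap'.le) hζabs (fun y => hζlip x y μ) α.1 hx hxe y
    obtain ⟨hBU, hIntα, hTreeα⟩ := hcube α
    have hG := H2 P hPd k hk1 hkmK _ hBU U Tu δ hIntα hTreeα hsmall x y
    have hG' : ‖gBox A P.eps⁻¹ U k (cubeFam hPd (P.L ^ k) c M0 s W α) x y‖ ≤ B₂ := by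
      refine hG.trans ?_
      rw [hB₂def]
      refine mul_le_mul_of_nonneg_left ?_ (by positivity)
      rw [hEdef, hTxy]
      exact exp_rate_le htt₂ hLk (Nat.cast_nonneg _)
    exact mul_le_mul hdw hG' (norm_nonneg _) hΛ0
  have hzero2 : ∀ α, α ∉ Sx ∪ Sx' → ((P.eps⁻¹ : ℝ) : ℂ) *
      ((((ζ x' y * lamFam hPd (P.L ^ k) c M0 s α x' y - ζ x y * lamFam hPd (P.L ^ k) c M0 s α x y : ℝ)) : ℂ) *
        gBox A P.eps⁻¹ U k (cubeFam hPd (P.L ^ k) c M0 s W α) x y) = 0 := by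
    intro α hα
    rw [Finset.mem_union, not_or] at hα
    have h1 : ζ x' y * lamFam hPd (P.L ^ k) c M0 s α x' y = 0 := by
      by_contra hne; exact hα.2 (hSx' α y hne)
    have h2 : ζ x y * lamFam hPd (P.L ^ k) c M0 s α x y = 0 := by
      by_contra hne; exact hα.1 (hSx α y hne)
    rw [h1, h2, sub_zero, Complex.ofReal_zero, zero_mul, mul_zero]
  have hcardU : ((Sx ∪ Sx').card : ℝ) ≤ 2 * m := by
    have h1 : ((Sx ∪ Sx').card : ℝ) ≤ (Sx.card : ℝ) + (Sx'.card : ℝ) := by exact_mod_cast Finset.card_union_le _ _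
    linarith
  have hsum2 : ‖∑ α, ((P.eps⁻¹ : ℝ) : ℂ) *
      ((((ζ x' y * lamFam hPd (P.L ^ k) c M0 s α x' y - ζ x y * lamFam hPd (P.L ^ k) c M0 s α x y : ℝ)) : ℂ) *
        gBox A P.eps⁻¹ U k (cubeFam hPd (P.L ^ k) c M0 s W α) x y)‖ ≤ 2 * m * (P.eps⁻¹ * (Λ * B₂)) := by
    rw [← Finset.sum_subset (Finset.subset_univ (Sx ∪ Sx')) (fun α _ hα => hzero2 α hα)]
    refine (norm_sum_le _ _).trans ?_
    refine (Finset.sum_le_sum fun α _ => hterm2 α).trans ?_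
    rw [Finset.sum_const, nsmul_eq_mul]
    exact mul_le_mul_of_nonneg_right hcardU (by positivity)
  -- assembling: `B₁ + 2m·ε⁻¹·Λ·B₂ ≤ (L^kε)·C·(1 + m·L^k((R₀−R₁)⁻¹ + s⁻¹))·E`
  have hscale : P.eps⁻¹ * P.spacing k ^ 2 = P.spacing k * (P.L : ℝ) ^ k := by
    rw [Params.spacing]
    field_simp
  have hΛle : Λ ≤ Λ₀ * ((R₀ - R₁)⁻¹ + (s : ℝ)⁻¹) := by
    rw [hΛdef, mul_add]
    refine add_le_add ?_ ?_
    · rw [div_eq_mul_inv]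
      exact mul_le_mul_of_nonneg_right (le_max_left _ _) (inv_pos.mpr hgap').le
    · have e : 3 * Real.pi * (d + 1 : ℕ) / (2 * s) = (3 * Real.pi * (d + 1 : ℕ) / 2) * (s : ℝ)⁻¹ := by
        field_simp
      rw [e]
      exact mul_le_mul_of_nonneg_right (le_max_right _ _) (inv_pos.mpr hsr).le
  have h1 : B₁ ≤ P.spacing k * (C * 1 * E) := by
    rw [hB₁def]
    have : c₁ * Real.exp t * P.spacing k * E = P.spacing k * (c₁ * Real.exp t * E) := by ring
    rw [this]
    refine mul_le_mul_of_nonneg_left ?_ hsp0.le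
    rw [mul_one]
    exact mul_le_mul_of_nonneg_right hC1 hE0.le
  have h2 : 2 * m * (P.eps⁻¹ * (Λ * B₂)) ≤ P.spacing k * (C * (m * ((P.L : ℝ) ^ k * ((R₀ - R₁)⁻¹ + (s : ℝ)⁻¹))) * E) := by
    have e : 2 * m * (P.eps⁻¹ * (Λ * B₂)) = P.spacing k * ((2 * c₂ * Λ) * (m * (P.L : ℝ) ^ k) * E) := by
      rw [hB₂def]
      have : 2 * m * (P.eps⁻¹ * (Λ * (c₂ * P.spacing k ^ 2 * E))) = (P.eps⁻¹ * P.spacing k ^ 2) * (2 * c₂ * Λ * m * E) := by ring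
      rw [this, hscale]; ring
    rw [e]
    refine mul_le_mul_of_nonneg_left ?_ hsp0.le
    refine mul_le_mul_of_nonneg_right ?_ hE0.le
    have h3 : 2 * c₂ * Λ ≤ C * ((R₀ - R₁)⁻¹ + (s : ℝ)⁻¹) := by
      calc 2 * c₂ * Λ ≤ 2 * c₂ * (Λ₀ * ((R₀ - R₁)⁻¹ + (s : ℝ)⁻¹)) := mul_le_mul_of_nonneg_left hΛle (by positivity)
        _ = (2 * c₂ * Λ₀) * ((R₀ - R₁)⁻¹ + (s : ℝ)⁻¹) := by ring
        _ ≤ C * ((R₀ - R₁)⁻¹ + (s : ℝ)⁻¹) := mul_le_mul_of_nonneg_right (by linarith) (by positivity)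
    calc 2 * c₂ * Λ * (m * (P.L : ℝ) ^ k) ≤ C * ((R₀ - R₁)⁻¹ + (s : ℝ)⁻¹) * (m * (P.L : ℝ) ^ k) :=
          mul_le_mul_of_nonneg_right h3 (by positivity)
      _ = C * (m * ((P.L : ℝ) ^ k * ((R₀ - R₁)⁻¹ + (s : ℝ)⁻¹))) := by ring
  refine ((norm_add_le _ _).trans (add_le_add hsum1 hsum2)).trans ?_
  calc B₁ + 2 * m * (P.eps⁻¹ * (Λ * B₂))
      ≤ P.spacing k * (C * 1 * E) + P.spacing k * (C * (m * ((P.L : ℝ) ^ k * ((R₀ - R₁)⁻¹ + (s : ℝ)⁻¹))) * E) := add_le_add h1 h2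
    _ = P.spacing k * (C * (1 + m * ((P.L : ℝ) ^ k * ((R₀ - R₁)⁻¹ + (s : ℝ)⁻¹))) * E) := by ring

end Deriv

/-! ## §4 The Hölder member of order `θ ≤ 1` of (2.30) at non-flat small fields, KERNEL FORM, along admissible contours -/

section Holder

open BIJ88NeumannPropagatorFlatDecayCube
open BIJ88LocWeights227Torus

variable {d : ℕ}

/-- kernel: for `1 ≤ t` and `θ ≤ 1`, `t^θ ≤ t`. [folklore] -/
private theorem rpow_le_self_of_one_le {t θ : ℝ} (ht : 1 ≤ t) (hθ : θ ≤ 1) : t ^ θ ≤ t := by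
  have h := Real.rpow_le_rpow_of_exponent_le ht hθ
  rwa [Real.rpow_one] at h

/-- kernel: `exp (-(t₁ * (n⁻¹ * T))) ≤ exp t₁ * exp (-(t * (n⁻¹ * D)))` when `0 < t ≤ t₁`, `0 < n`, `0 ≤ D`, `D - n ≤ T`. [folklore] -/
private theorem exp_near_le {t t₁ n D T : ℝ} (ht : 0 < t) (ht₁ : t ≤ t₁) (hn : 0 < n) (hD : 0 ≤ D) (hT : D - n ≤ T) :
    Real.exp (-(t₁ * (n⁻¹ * T))) ≤ Real.exp t₁ * Real.exp (-(t * (n⁻¹ * D))) := by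
  rw [← Real.exp_add]
  refine Real.exp_le_exp.2 ?_
  have h1 : n⁻¹ * (D - n) ≤ n⁻¹ * T := mul_le_mul_of_nonneg_left hT (inv_pos.2 hn).le
  have h2 : n⁻¹ * (D - n) = n⁻¹ * D - 1 := by field_simp
  have h3 : t * (n⁻¹ * D) ≤ t₁ * (n⁻¹ * D) := mul_le_mul_of_nonneg_right ht₁ (by positivity)
  have h4 : t₁ * (n⁻¹ * D - 1) ≤ t₁ * (n⁻¹ * T) := mul_le_mul_of_nonneg_left (h2 ▸ h1) (ht.le.trans ht₁)
  nlinarith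

/-- **THE HÖLDER MEMBER OF ORDER `θ ≤ 1` OF (2.30) AT NON-FLAT SMALL FIELDS, KERNEL FORM, FOR THE TORUS CUBES AND WEIGHTS OF RECORD AND ANY
LIPSCHITZ CUT-OFF, ALONG EVERY ADMISSIBLE CONTOUR** (p. 263: *"Bounds analogous to (2.30), (2.31) hold for covariant derivatives and Hölder
derivatives of G_{k,loc}(u) of order less than two"*; [6] p. 573: *"for an arbitrary pair of points x, x′ ∈ ηZ^d, let us denote by Γ_{x,x′} a
shortest contour connecting these points"*, the transport `U(A(Γ_{x,x′}))` of (1.9)).  For every `K ≥ 0` THERE EXIST `t₀, C > 0` depending on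
`(d, a, K)` only such that, for all data as in `deriv230_smallField_of_lipschitz`, EVERY exponent `0 ≤ θ ≤ 1`, every pair `x₁, x₂` joined by a
bond chain `Γ = (x₁ = s_0, s_1, …, s_n = x₂)` (`c_m` joins `s_m` to `s_{m+1}`) of `n ≤ (d+1)|x₁ − x₂|_T` steps all of whose sites lie in `Ω₀` at
chart depth `≥ R₀` and within sup-torus distance `|x₁ − x₂|_T` of `x₁` (every `ℓ¹`-geodesic of the chart between two deep points is such a
contour), and every column `y` at sup-torus distance `≥ D ≥ 0` from `x₁` and from `x₂`:
`(L^k/|x₁ − x₂|_T)^θ·‖u(Γ)G_{k,loc}(u; x₂, y) − G_{k,loc}(u; x₁, y)‖ ≤ (L^kε)²·C·(1 + m·L^k·((R₀ − R₁)⁻¹ + s⁻¹))·e^{−t₀D/L^k}`,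
`u(Γ) = Π_m u(c_m)^{±1}` the parallel transport along `Γ` (`T4TreeGaugeTransform.chainHol`), `m = (⌊(L^k − 1 + R₀)/s⌋ + 3)^{d+1}` — near pairs
(`|x₁ − x₂|_T ≤ L^k`): the derivative member telescoped along `Γ` (`norm_transport_sub_le_sum_covD`), `(L^k/T)^θ·(d+1)T·ε ≤ (d+1)L^kε`; far
pairs: two value members (`decay_gLocT_smallField_kernel_loc`), `|u(Γ)| = 1`. [cite: BalabanImbrieJaffe1988, (2.30) p.263] -/
theorem holder230_smallField_of_lipschitz (d : ℕ) {a : ℝ} (ha : 0 < a) {K : ℝ} (hK0 : 0 ≤ K) :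
    ∃ t₀ C : ℝ, 0 < t₀ ∧ 0 < C ∧ ∀ (P : Params) (hPd : P.d = d + 1),
      ∀ k : ℕ, 1 ≤ k → k ≤ P.m + P.K → ∀ (c M0 : Fin (d + 1) → ℕ), (∀ i, 1 ≤ M0 i) →
        (∀ i, c i * P.L ^ k + P.L ^ k * M0 i ≤ P.sitesPerDir 0) → (∀ i, P.L ^ k * M0 i < P.sitesPerDir 0) →
      ∀ (s W : ℕ), 1 ≤ s → ∀ (R R₀ R₁ : ℝ), 1 < R → 0 ≤ R₁ → R₁ < R₀ → 2 * (s : ℝ) / 3 + R₀ / 2 + R ≤ W →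
        (∀ i, ((P.L ^ k * M0 i : ℕ) : ℝ) + R ≤ P.sitesPerDir 0) →
      ∀ (ζ : Balaban1983to89.Site P 0 → Balaban1983to89.Site P 0 → ℝ), (∀ x y, |ζ x y| ≤ 1) →
        (∀ x y, R₀ ≤ B5Ineq137Torus.T P 0 x y → ζ x y = 0) →
        (∀ (x y : Balaban1983to89.Site P 0) (ν : Fin P.d), |ζ (x.shift ν) y - ζ x y| ≤ K / (R₀ - R₁)) →
      ∀ (U : GaugeField P 0 U1) (Tu δ : ℝ),
        (∀ b ∈ starB (cubeT hPd (P.L ^ k) c fun i => P.L ^ k * M0 i), blkIter k b.src = blkIter k b.tgt → ‖toC (U b) - 1‖ ≤ Tu) →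
        (∀ x ∈ (cubeT hPd (P.L ^ k) c fun i => P.L ^ k * M0 i), ‖holCK U k x - 1‖ ≤ δ) →
        2 * (((P.L : ℝ) ^ k - 1) * (P.L : ℝ) ^ k) * P.d * Tu ^ 2 + 2 * δ ^ 2 ≤ 1 / 2 →
      ∀ (θ : ℝ), 0 ≤ θ → θ ≤ 1 →
      ∀ (x₁ x₂ : Balaban1983to89.Site P 0) (n : ℕ) (sq : ℕ → Balaban1983to89.Site P 0) (cb : ℕ → PBond P 0),
        sq 0 = x₁ → sq n = x₂ → (∀ m < n, Joins (cb m) (sq m) (sq (m + 1))) →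
        (n : ℝ) ≤ ((d : ℝ) + 1) * B5Ineq137Torus.T P 0 x₁ x₂ →
        (∀ m ≤ n, sq m ∈ (cubeT hPd (P.L ^ k) c fun i => P.L ^ k * M0 i) ∧
          (∀ i, R₀ ≤ (boxCoord hPd (P.L ^ k) c (sq m) i : ℝ) ∧ (boxCoord hPd (P.L ^ k) c (sq m) i : ℝ) + R₀ ≤ (P.L ^ k * M0 i : ℕ) - 1) ∧
          B5Ineq137Torus.T P 0 x₁ (sq m) ≤ B5Ineq137Torus.T P 0 x₁ x₂) →
      ∀ (y : Balaban1983to89.Site P 0) (D : ℝ), 0 ≤ D → D ≤ B5Ineq137Torus.T P 0 x₁ y → D ≤ B5Ineq137Torus.T P 0 x₂ y →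
        ((P.L : ℝ) ^ k / B5Ineq137Torus.T P 0 x₁ x₂) ^ θ *
          ‖toC (chainHol sq cb U n) *
              gLocT (B1RG242Torus.α P a k * (P.L : ℝ) ^ (k * P.d)) P.eps⁻¹ U k (cubeFam hPd (P.L ^ k) c M0 s W)
                (lamFam hPd (P.L ^ k) c M0 s) ζ x₂ y -
            gLocT (B1RG242Torus.α P a k * (P.L : ℝ) ^ (k * P.d)) P.eps⁻¹ U k (cubeFam hPd (P.L ^ k) c M0 s W)
                (lamFam hPd (P.L ^ k) c M0 s) ζ x₁ y‖ ≤
          P.spacing k ^ 2 * (C * (1 + (⌊(((P.L : ℝ) ^ k) - 1 + R₀) / s⌋₊ + 3) ^ (d + 1) *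
            ((P.L : ℝ) ^ k * ((R₀ - R₁)⁻¹ + (s : ℝ)⁻¹))) * Real.exp (-(t₀ * (((P.L : ℝ) ^ k)⁻¹ * D)))) := by
  obtain ⟨t₁, C₁, ht₁, hC₁, H1⟩ := deriv230_smallField_of_lipschitz d ha hK0
  obtain ⟨t₃, c₃, ht₃, hc₃, H3⟩ := decay_gLocT_smallField_kernel_loc d ha
  set t : ℝ := min t₁ t₃ with htdef
  have ht0 : 0 < t := lt_min ht₁ ht₃
  have htt₁ : t ≤ t₁ := min_le_left _ _
  have htt₃ : t ≤ t₃ := min_le_right _ _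
  refine ⟨t, max (((d : ℝ) + 1) * Real.exp t₁ * C₁) (2 * c₃), ht0, lt_max_of_lt_right (by positivity), ?_⟩
  intro P hPd k hk1 hkmK c M0 hM0 hfit0 hN0 s W hs R R₀ R₁ hR hR₁ hR10 hW hgap ζ hζabs hζ0 hζlip U Tu δ hInt hTree hsmall
    θ hθ0 hθ1 x₁ x₂ n sq cb hsq0 hsqn hJ hnle hchain y D hD hD₁ hD₂
  set C := max (((d : ℝ) + 1) * Real.exp t₁ * C₁) (2 * c₃) with hCdef
  have hCa : ((d : ℝ) + 1) * Real.exp t₁ * C₁ ≤ C := le_max_left _ _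
  have hCb : 2 * c₃ ≤ C := le_max_right _ _
  have hC0 : 0 ≤ C := le_trans (by positivity) hCb
  have hLpos : (0 : ℝ) < P.L := P.cast_L_pos
  have hLk : (0 : ℝ) < (P.L : ℝ) ^ k := pow_pos hLpos _
  have hLkinv : 0 < ((P.L : ℝ) ^ k)⁻¹ := inv_pos.mpr hLk
  have hsp0 : 0 < P.spacing k := P.spacing_pos k
  have heps : 0 < P.eps := P.eps_pos
  have hT0 : 0 ≤ B5Ineq137Torus.T P 0 x₁ x₂ := B5Ineq137Torus.T_nonneg P 0 x₁ x₂
  -- abbreviations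
  set A : ℝ := B1RG242Torus.α P a k * (P.L : ℝ) ^ (k * P.d) with hAdef
  set ψ : Balaban1983to89.Site P 0 → ℂ := fun z =>
    gLocT A P.eps⁻¹ U k (cubeFam hPd (P.L ^ k) c M0 s W) (lamFam hPd (P.L ^ k) c M0 s) ζ z y with hψdef
  set T12 : ℝ := B5Ineq137Torus.T P 0 x₁ x₂ with hT12def
  set m : ℝ := ((⌊(((P.L : ℝ) ^ k) - 1 + R₀) / s⌋₊ : ℝ) + 3) ^ (d + 1) with hmdef
  have hm0 : 0 ≤ m := by rw [hmdef]; positivity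
  set br : ℝ := 1 + m * ((P.L : ℝ) ^ k * ((R₀ - R₁)⁻¹ + (s : ℝ)⁻¹)) with hbrdef
  have hbr1 : 1 ≤ br := by
    rw [hbrdef]; exact le_add_of_nonneg_right (by rw [hmdef]; positivity)
  have hbr0 : 0 ≤ br := zero_le_one.trans hbr1
  set Ex : ℝ := Real.exp (-(t * (((P.L : ℝ) ^ k)⁻¹ * D))) with hEdef
  have hE0 : 0 < Ex := Real.exp_pos _
  have hεD : 0 ≤ ((P.L : ℝ) ^ k)⁻¹ * D := mul_nonneg hLkinv.le hD
  set w : ℝ := ((P.L : ℝ) ^ k / T12) ^ θ with hwdef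
  have hw0 : 0 ≤ w := Real.rpow_nonneg (div_nonneg hLk.le hT0) θ
  show w * ‖toC (chainHol sq cb U n) * ψ x₂ - ψ x₁‖ ≤ P.spacing k ^ 2 * (C * br * Ex)
  by_cases hnear : T12 ≤ (P.L : ℝ) ^ k
  · /- NEAR PAIRS: the derivative member telescoped along the contour -/
    set B : ℝ := P.spacing k * (C₁ * br * (Real.exp t₁ * Ex)) with hBdef
    have hB0 : 0 ≤ B := by positivity
    have hbond : ∀ m' < n, ‖covD P.eps⁻¹ (cfg U) ψ (cb m')‖ ≤ B := by
      intro m' hm'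
      obtain ⟨hmem0, hdeep0, hclose0⟩ := hchain m' hm'.le
      obtain ⟨hmem1, hdeep1, hclose1⟩ := hchain (m' + 1) (Nat.succ_le_of_lt hm')
      -- the bond, its base point and direction
      have hb : cb m' = ⟨(cb m').src, (cb m').dir⟩ := rfl
      have htgt : (cb m').tgt = (cb m').src.shift (cb m').dir := rfl
      -- both endpoints are chain sites
      have hends : ((cb m').src ∈ (cubeT hPd (P.L ^ k) c fun i => P.L ^ k * M0 i) ∧
          (∀ i, R₀ ≤ (boxCoord hPd (P.L ^ k) c (cb m').src i : ℝ) ∧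
            (boxCoord hPd (P.L ^ k) c (cb m').src i : ℝ) + R₀ ≤ (P.L ^ k * M0 i : ℕ) - 1) ∧
          B5Ineq137Torus.T P 0 x₁ (cb m').src ≤ T12) ∧
          ((cb m').src.shift (cb m').dir ∈ (cubeT hPd (P.L ^ k) c fun i => P.L ^ k * M0 i) ∧
          (∀ i, R₀ ≤ (boxCoord hPd (P.L ^ k) c ((cb m').src.shift (cb m').dir) i : ℝ) ∧
            (boxCoord hPd (P.L ^ k) c ((cb m').src.shift (cb m').dir) i : ℝ) + R₀ ≤ (P.L ^ k * M0 i : ℕ) - 1)) := by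
        rw [← htgt]
        rcases hJ m' hm' with ⟨h1, h2⟩ | ⟨h1, h2⟩
        · rw [h1, h2]; exact ⟨⟨hmem0, hdeep0, hclose0⟩, hmem1, hdeep1⟩
        · rw [h1, h2]; exact ⟨⟨hmem1, hdeep1, hclose1⟩, hmem0, hdeep0⟩
      obtain ⟨⟨hzmem, hzdeep, hzclose⟩, hzemem, hzedeep⟩ := hends
      have hder := H1 P hPd k hk1 hkmK c M0 hM0 hfit0 hN0 s W hs R R₀ R₁ hR hR₁ hR10 hW hgap ζ hζabs hζ0 hζlip U Tu δ hInt hTree hsmall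
        (cb m').src (cb m').dir hzmem hzdeep hzemem hzedeep y
      rw [← hb] at hder
      refine hder.trans ?_
      -- the exponent: `|src − y|_T ≥ D − T12 ≥ D − L^k`
      have hTz : D - (P.L : ℝ) ^ k ≤ B5Ineq137Torus.T P 0 (cb m').src y := by
        have htri := B5Ineq137Torus.T_triangle P 0 x₁ (cb m').src y
        linarith
      have hexp := exp_near_le ht0 htt₁ hLk hD hTz
      rw [hBdef, ← hmdef]
      refine mul_le_mul_of_nonneg_left ?_ hsp0.le
      exact mul_le_mul_of_nonneg_left hexp (by positivity)
    -- telescoping along the contour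
    have htel := norm_transport_sub_le_sum_covD U (inv_ne_zero heps.ne') ψ sq cb n hJ
    rw [hsq0, hsqn, abs_inv, abs_of_pos heps, inv_inv] at htel
    have hsum : ∑ m' ∈ Finset.range n, ‖covD P.eps⁻¹ (cfg U) ψ (cb m')‖ ≤ n * B := by
      calc ∑ m' ∈ Finset.range n, ‖covD P.eps⁻¹ (cfg U) ψ (cb m')‖ ≤ ∑ _m' ∈ Finset.range n, B :=
            Finset.sum_le_sum fun m' hm' => hbond m' (Finset.mem_range.1 hm')
        _ = n * B := by rw [Finset.sum_const, Finset.card_range, nsmul_eq_mul]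
    have hdiff : ‖toC (chainHol sq cb U n) * ψ x₂ - ψ x₁‖ ≤ P.eps * (n * B) :=
      htel.trans (mul_le_mul_of_nonneg_left hsum heps.le)
    -- the weight against the number of steps: `w·ε·n ≤ (d+1)·L^k·ε`
    have hwT : w * (P.eps * (n * B)) ≤ ((d : ℝ) + 1) * (P.eps * (P.L : ℝ) ^ k) * B := by
      rcases hT0.eq_or_lt with hT00 | hTpos
      · -- `x₁`, `x₂` at torus distance `0`: no steps
        have hn0 : (n : ℝ) = 0 := le_antisymm (by rw [← hT00, mul_zero] at hnle; exact hnle) (Nat.cast_nonneg n)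
        rw [hn0, zero_mul, mul_zero, mul_zero]
        positivity
      · have hq : 1 ≤ (P.L : ℝ) ^ k / T12 := by rw [le_div_iff₀ hTpos, one_mul]; exact hnear
        have hw1 : w ≤ (P.L : ℝ) ^ k / T12 := rpow_le_self_of_one_le hq hθ1
        calc w * (P.eps * (n * B)) ≤ (P.L : ℝ) ^ k / T12 * (P.eps * ((((d : ℝ) + 1) * T12) * B)) :=
              mul_le_mul hw1 (mul_le_mul_of_nonneg_left (mul_le_mul_of_nonneg_right hnle hB0) heps.le) (by positivity)
                (div_nonneg hLk.le hT0)
          _ = ((d : ℝ) + 1) * (P.eps * (P.L : ℝ) ^ k) * B := by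
              rw [div_mul_eq_mul_div, div_eq_iff hTpos.ne']
              ring
    have hspacing : P.eps * (P.L : ℝ) ^ k = P.spacing k := by rw [Params.spacing]; ring
    calc w * ‖toC (chainHol sq cb U n) * ψ x₂ - ψ x₁‖ ≤ w * (P.eps * (n * B)) := mul_le_mul_of_nonneg_left hdiff hw0
      _ ≤ ((d : ℝ) + 1) * (P.eps * (P.L : ℝ) ^ k) * B := hwT
      _ = P.spacing k ^ 2 * ((((d : ℝ) + 1) * Real.exp t₁ * C₁) * br * Ex) := by rw [hspacing, hBdef]; ring
      _ ≤ P.spacing k ^ 2 * (C * br * Ex) := by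
          refine mul_le_mul_of_nonneg_left ?_ (sq_nonneg _)
          exact mul_le_mul_of_nonneg_right (mul_le_mul_of_nonneg_right hCa hbr0) hE0.le
  · /- FAR PAIRS: two value members -/
    push Not at hnear
    have hTpos : 0 < T12 := hLk.trans hnear
    have hw1 : w ≤ 1 := by
      refine Real.rpow_le_one (div_nonneg hLk.le hT0) ?_ hθ0
      rw [div_le_one hTpos]; exact hnear.le
    have hval : ∀ x : Balaban1983to89.Site P 0, D ≤ B5Ineq137Torus.T P 0 x y → ‖ψ x‖ ≤ c₃ * P.spacing k ^ 2 * Ex := by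
      intro x hx
      refine (H3 P hPd k hk1 hkmK c M0 hM0 hfit0 hN0 s W ζ hζabs U Tu δ hInt hTree hsmall x y).trans ?_
      refine mul_le_mul_of_nonneg_left (Real.exp_le_exp.2 ?_) (by positivity)
      have h1 : t * (((P.L : ℝ) ^ k)⁻¹ * D) ≤ t₃ * (((P.L : ℝ) ^ k)⁻¹ * B5Ineq137Torus.T P 0 x y) :=
        mul_le_mul htt₃ (mul_le_mul_of_nonneg_left hx hLkinv.le) hεD ht₃.le
      linarith
    have h1 := hval x₁ hD₁
    have h2 := hval x₂ hD₂
    have hsub : ‖toC (chainHol sq cb U n) * ψ x₂ - ψ x₁‖ ≤ c₃ * P.spacing k ^ 2 * Ex + c₃ * P.spacing k ^ 2 * Ex := by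
      refine (norm_sub_le _ _).trans (add_le_add ?_ h1)
      rw [norm_mul, norm_toC, one_mul]; exact h2
    calc w * ‖toC (chainHol sq cb U n) * ψ x₂ - ψ x₁‖ ≤ ‖toC (chainHol sq cb U n) * ψ x₂ - ψ x₁‖ :=
          mul_le_of_le_one_left (norm_nonneg _) hw1
      _ ≤ c₃ * P.spacing k ^ 2 * Ex + c₃ * P.spacing k ^ 2 * Ex := hsub
      _ = P.spacing k ^ 2 * ((2 * c₃) * 1 * Ex) := by ring
      _ ≤ P.spacing k ^ 2 * (C * br * Ex) := by
          refine mul_le_mul_of_nonneg_left ?_ (sq_nonneg _)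
          exact mul_le_mul_of_nonneg_right (mul_le_mul hCb hbr1 zero_le_one hC0) hE0.le

end Holder

/-! ## §5 The members for the two cut-offs of record: p13's `cutoff R₁ R₀ |·|_T` of (2.29) and r18's smooth product cut-off `ζ^Π(R₁, R₀)` -/

section Instances

open BIJ88NeumannPropagatorFlatDecayCube
open BIJ88LocWeights227Torus
open BIJ88Cutoffs21 (cutoff cutoff_nonneg cutoff_le_one)
open BIJ88LocDeriv230FlatTorus (exists_abs_cutoff_sub_le abs_T_shift_sub_le)
open BIJ88LocDeriv230ZetaPiFlatTorus (zetaPi_zero_eq_zero_of_le abs_zetaPi_zero_le_one abs_zetaPi_zero_shift_sub_le)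
open BIJ88HkLocHolderTorus (zetaPi)
open Literature.Analysis.Calculus (exists_abs_deriv_and_deriv_deriv_smoothTransition_le)

variable {d : ℕ}

/-- the three cut-off hypotheses of the generic members for p13's cut-off of record `ζ″ = σ((R₀ − |x − y|_T)/(R₀ − R₁))` (gen 27's
universal Lipschitz constant `K_σ`, one lattice step moves `|·|_T` by `≤ 1`). [cite: BalabanImbrieJaffe1988, (2.29) p.263] -/
theorem cutoff_hyps {K R₁ R₀ : ℝ} (hK : ∀ (a b a' b' : Balaban1983to89.Site P 0),
      |cutoff R₁ R₀ (B5Ineq137Torus.T P 0) a b - cutoff R₁ R₀ (B5Ineq137Torus.T P 0) a' b'| ≤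
        K / (R₀ - R₁) * |B5Ineq137Torus.T P 0 a b - B5Ineq137Torus.T P 0 a' b'|) (hK0 : 0 ≤ K) (hR : R₁ < R₀) :
    (∀ x y : Balaban1983to89.Site P 0, |cutoff R₁ R₀ (B5Ineq137Torus.T P 0) x y| ≤ 1) ∧
    (∀ x y : Balaban1983to89.Site P 0, R₀ ≤ B5Ineq137Torus.T P 0 x y → cutoff R₁ R₀ (B5Ineq137Torus.T P 0) x y = 0) ∧
    (∀ (x y : Balaban1983to89.Site P 0) (ν : Fin P.d),
      |cutoff R₁ R₀ (B5Ineq137Torus.T P 0) (x.shift ν) y - cutoff R₁ R₀ (B5Ineq137Torus.T P 0) x y| ≤ K / (R₀ - R₁)) := by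
  refine ⟨fun x y => ?_, cutoff_eq_zero_of_le hR, fun x y ν => ?_⟩
  · rw [abs_of_nonneg (cutoff_nonneg _ _ _ _ _)]; exact cutoff_le_one _ _ _ _ _
  · refine (hK (x.shift ν) y x y).trans ?_
    have hgap : 0 ≤ K / (R₀ - R₁) := div_nonneg hK0 (sub_pos.2 hR).le
    calc K / (R₀ - R₁) * |B5Ineq137Torus.T P 0 (x.shift ν) y - B5Ineq137Torus.T P 0 x y| ≤ K / (R₀ - R₁) * 1 :=
          mul_le_mul_of_nonneg_left (abs_T_shift_sub_le x y ν) hgap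
      _ = K / (R₀ - R₁) := mul_one _

/-- **THE COVARIANT-DERIVATIVE MEMBER OF (2.30) AT NON-FLAT SMALL FIELDS, KERNEL FORM, FOR THE PRINTED LOCALIZATION DATA OF RECORD**
(gen 26's torus cubes `{□_α}`, weights `λ_α` of (2.27), p13's cut-off of (2.29)): THERE EXIST `t₀, C > 0` depending on `(d, a)` only (and the
universal profile constant `K_σ` of gen 27's `exists_abs_cutoff_sub_le`) such that, for all data as in `deriv230_smallField_of_lipschitz`,
`‖ε⁻¹(u(b)G_{k,loc}(u; x + e_μ, y) − G_{k,loc}(u; x, y))‖ ≤ (L^kε)·C·(1 + m·L^k((R₀ − R₁)⁻¹ + s⁻¹))·e^{−t₀|x − y|_T/L^k}` — print's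
*"bounds analogous to (2.30) … for covariant derivatives … of G_{k,loc}(u)"* AT THE NON-FLAT SMALL FIELDS `u` of p. 263, on the kernel.
[cite: BalabanImbrieJaffe1988, (2.30) p.263] -/
theorem deriv230_smallField_cwt (d : ℕ) {a : ℝ} (ha : 0 < a) :
    ∃ t₀ C : ℝ, 0 < t₀ ∧ 0 < C ∧ ∀ (P : Params) (hPd : P.d = d + 1),
      ∀ k : ℕ, 1 ≤ k → k ≤ P.m + P.K → ∀ (c M0 : Fin (d + 1) → ℕ), (∀ i, 1 ≤ M0 i) →
        (∀ i, c i * P.L ^ k + P.L ^ k * M0 i ≤ P.sitesPerDir 0) → (∀ i, P.L ^ k * M0 i < P.sitesPerDir 0) →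
      ∀ (s W : ℕ), 1 ≤ s → ∀ (R R₀ R₁ : ℝ), 1 < R → 0 ≤ R₁ → R₁ < R₀ → 2 * (s : ℝ) / 3 + R₀ / 2 + R ≤ W →
        (∀ i, ((P.L ^ k * M0 i : ℕ) : ℝ) + R ≤ P.sitesPerDir 0) →
      ∀ (U : GaugeField P 0 U1) (Tu δ : ℝ),
        (∀ b ∈ starB (cubeT hPd (P.L ^ k) c fun i => P.L ^ k * M0 i), blkIter k b.src = blkIter k b.tgt → ‖toC (U b) - 1‖ ≤ Tu) →
        (∀ x ∈ (cubeT hPd (P.L ^ k) c fun i => P.L ^ k * M0 i), ‖holCK U k x - 1‖ ≤ δ) →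
        2 * (((P.L : ℝ) ^ k - 1) * (P.L : ℝ) ^ k) * P.d * Tu ^ 2 + 2 * δ ^ 2 ≤ 1 / 2 →
      ∀ (x : Balaban1983to89.Site P 0) (μ : Fin P.d),
        x ∈ (cubeT hPd (P.L ^ k) c fun i => P.L ^ k * M0 i) →
        (∀ i, R₀ ≤ (boxCoord hPd (P.L ^ k) c x i : ℝ) ∧ (boxCoord hPd (P.L ^ k) c x i : ℝ) + R₀ ≤ (P.L ^ k * M0 i : ℕ) - 1) →
        x.shift μ ∈ (cubeT hPd (P.L ^ k) c fun i => P.L ^ k * M0 i) →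
        (∀ i, R₀ ≤ (boxCoord hPd (P.L ^ k) c (x.shift μ) i : ℝ) ∧
          (boxCoord hPd (P.L ^ k) c (x.shift μ) i : ℝ) + R₀ ≤ (P.L ^ k * M0 i : ℕ) - 1) →
      ∀ y : Balaban1983to89.Site P 0,
        ‖covD P.eps⁻¹ (cfg U) (fun z =>
            gLocT (B1RG242Torus.α P a k * (P.L : ℝ) ^ (k * P.d)) P.eps⁻¹ U k (cubeFam hPd (P.L ^ k) c M0 s W)
              (lamFam hPd (P.L ^ k) c M0 s) (cutoff R₁ R₀ (B5Ineq137Torus.T P 0)) z y) ⟨x, μ⟩‖ ≤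
          P.spacing k * (C * (1 + (⌊(((P.L : ℝ) ^ k) - 1 + R₀) / s⌋₊ + 3) ^ (d + 1) *
            ((P.L : ℝ) ^ k * ((R₀ - R₁)⁻¹ + (s : ℝ)⁻¹))) * Real.exp (-(t₀ * (((P.L : ℝ) ^ k)⁻¹ * B5Ineq137Torus.T P 0 x y)))) := by
  obtain ⟨K, hK0, hK⟩ := exists_abs_cutoff_sub_le.{0, 0}
  obtain ⟨t₀, C, ht₀, hC, H⟩ := deriv230_smallField_of_lipschitz d ha hK0
  refine ⟨t₀, C, ht₀, hC, ?_⟩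
  intro P hPd k hk1 hk c M0 hM0 hfit0 hN0 s W hs R R₀ R₁ hR hR₁ hR10 hW hgap U Tu δ hInt hTree hsmall x μ hx hdeep hxe hdeepe y
  obtain ⟨h1, h2, h3⟩ := cutoff_hyps (hK R₁ R₀ hR10 (B5Ineq137Torus.T P 0)) hK0 hR10
  exact H P hPd k hk1 hk c M0 hM0 hfit0 hN0 s W hs R R₀ R₁ hR hR₁ hR10 hW hgap _ h1 h2 h3 U Tu δ hInt hTree hsmall x μ hx hdeep hxe hdeepe y

/-- **THE SAME FOR THE SMOOTH PRODUCT CUT-OFF `ζ″ = ζ^Π(R₁, R₀)`** (r18's `zetaPi`; gen 28's scale-0 facts `zetaPi_zero_eq_zero_of_le`,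
`abs_zetaPi_zero_shift_sub_le`, the tree's universal bound `C_σ` on `|σ′|`). [cite: BalabanImbrieJaffe1988, (2.30) p.263] -/
theorem deriv230_smallField_zetaPi (d : ℕ) {a : ℝ} (ha : 0 < a) :
    ∃ t₀ C : ℝ, 0 < t₀ ∧ 0 < C ∧ ∀ (P : Params) (hPd : P.d = d + 1),
      ∀ k : ℕ, 1 ≤ k → k ≤ P.m + P.K → ∀ (c M0 : Fin (d + 1) → ℕ), (∀ i, 1 ≤ M0 i) →
        (∀ i, c i * P.L ^ k + P.L ^ k * M0 i ≤ P.sitesPerDir 0) → (∀ i, P.L ^ k * M0 i < P.sitesPerDir 0) →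
      ∀ (s W : ℕ), 1 ≤ s → ∀ (R R₀ R₁ : ℝ), 1 < R → 0 ≤ R₁ → R₁ < R₀ → 2 * (s : ℝ) / 3 + R₀ / 2 + R ≤ W →
        (∀ i, ((P.L ^ k * M0 i : ℕ) : ℝ) + R ≤ P.sitesPerDir 0) →
      ∀ (U : GaugeField P 0 U1) (Tu δ : ℝ),
        (∀ b ∈ starB (cubeT hPd (P.L ^ k) c fun i => P.L ^ k * M0 i), blkIter k b.src = blkIter k b.tgt → ‖toC (U b) - 1‖ ≤ Tu) →
        (∀ x ∈ (cubeT hPd (P.L ^ k) c fun i => P.L ^ k * M0 i), ‖holCK U k x - 1‖ ≤ δ) →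
        2 * (((P.L : ℝ) ^ k - 1) * (P.L : ℝ) ^ k) * P.d * Tu ^ 2 + 2 * δ ^ 2 ≤ 1 / 2 →
      ∀ (x : Balaban1983to89.Site P 0) (μ : Fin P.d),
        x ∈ (cubeT hPd (P.L ^ k) c fun i => P.L ^ k * M0 i) →
        (∀ i, R₀ ≤ (boxCoord hPd (P.L ^ k) c x i : ℝ) ∧ (boxCoord hPd (P.L ^ k) c x i : ℝ) + R₀ ≤ (P.L ^ k * M0 i : ℕ) - 1) →
        x.shift μ ∈ (cubeT hPd (P.L ^ k) c fun i => P.L ^ k * M0 i) →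
        (∀ i, R₀ ≤ (boxCoord hPd (P.L ^ k) c (x.shift μ) i : ℝ) ∧
          (boxCoord hPd (P.L ^ k) c (x.shift μ) i : ℝ) + R₀ ≤ (P.L ^ k * M0 i : ℕ) - 1) →
      ∀ y : Balaban1983to89.Site P 0,
        ‖covD P.eps⁻¹ (cfg U) (fun z =>
            gLocT (B1RG242Torus.α P a k * (P.L : ℝ) ^ (k * P.d)) P.eps⁻¹ U k (cubeFam hPd (P.L ^ k) c M0 s W)
              (lamFam hPd (P.L ^ k) c M0 s) (zetaPi R₁ R₀ 0) z y) ⟨x, μ⟩‖ ≤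
          P.spacing k * (C * (1 + (⌊(((P.L : ℝ) ^ k) - 1 + R₀) / s⌋₊ + 3) ^ (d + 1) *
            ((P.L : ℝ) ^ k * ((R₀ - R₁)⁻¹ + (s : ℝ)⁻¹))) * Real.exp (-(t₀ * (((P.L : ℝ) ^ k)⁻¹ * B5Ineq137Torus.T P 0 x y)))) := by
  obtain ⟨Cσ, hC0, hC1, -⟩ := exists_abs_deriv_and_deriv_deriv_smoothTransition_le
  obtain ⟨t₀, C, ht₀, hC, H⟩ := deriv230_smallField_of_lipschitz d ha hC0
  refine ⟨t₀, C, ht₀, hC, ?_⟩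
  intro P hPd k hk1 hk c M0 hM0 hfit0 hN0 s W hs R R₀ R₁ hR hR₁ hR10 hW hgap U Tu δ hInt hTree hsmall x μ hx hdeep hxe hdeepe y
  exact H P hPd k hk1 hk c M0 hM0 hfit0 hN0 s W hs R R₀ R₁ hR hR₁ hR10 hW hgap _ (abs_zetaPi_zero_le_one R₁ R₀)
    (zetaPi_zero_eq_zero_of_le hR10) (abs_zetaPi_zero_shift_sub_le hC1 hR10) U Tu δ hInt hTree hsmall x μ hx hdeep hxe hdeepe y

/-- **THE HÖLDER MEMBER OF ORDER `θ ≤ 1` OF (2.30) AT NON-FLAT SMALL FIELDS, KERNEL FORM, FOR THE PRINTED LOCALIZATION DATA OF RECORD**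
(p13's cut-off of (2.29)), along every admissible contour: for all data as in `holder230_smallField_of_lipschitz`,
`(L^k/|x₁ − x₂|_T)^θ·‖u(Γ)G_{k,loc}(u; x₂, y) − G_{k,loc}(u; x₁, y)‖ ≤ (L^kε)²·C·(1 + m·L^k((R₀ − R₁)⁻¹ + s⁻¹))·e^{−t₀D/L^k}`, constants
from `(d, a)` and the universal `K_σ` — print's *"bounds analogous to (2.30) … for … Hölder derivatives of G_{k,loc}(u) of order less than
two"*, the order `θ ≤ 1` member at the non-flat small fields of p. 263, on the kernel. [cite: BalabanImbrieJaffe1988, (2.30) p.263] -/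
theorem holder230_smallField_cwt (d : ℕ) {a : ℝ} (ha : 0 < a) :
    ∃ t₀ C : ℝ, 0 < t₀ ∧ 0 < C ∧ ∀ (P : Params) (hPd : P.d = d + 1),
      ∀ k : ℕ, 1 ≤ k → k ≤ P.m + P.K → ∀ (c M0 : Fin (d + 1) → ℕ), (∀ i, 1 ≤ M0 i) →
        (∀ i, c i * P.L ^ k + P.L ^ k * M0 i ≤ P.sitesPerDir 0) → (∀ i, P.L ^ k * M0 i < P.sitesPerDir 0) →
      ∀ (s W : ℕ), 1 ≤ s → ∀ (R R₀ R₁ : ℝ), 1 < R → 0 ≤ R₁ → R₁ < R₀ → 2 * (s : ℝ) / 3 + R₀ / 2 + R ≤ W →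
        (∀ i, ((P.L ^ k * M0 i : ℕ) : ℝ) + R ≤ P.sitesPerDir 0) →
      ∀ (U : GaugeField P 0 U1) (Tu δ : ℝ),
        (∀ b ∈ starB (cubeT hPd (P.L ^ k) c fun i => P.L ^ k * M0 i), blkIter k b.src = blkIter k b.tgt → ‖toC (U b) - 1‖ ≤ Tu) →
        (∀ x ∈ (cubeT hPd (P.L ^ k) c fun i => P.L ^ k * M0 i), ‖holCK U k x - 1‖ ≤ δ) →
        2 * (((P.L : ℝ) ^ k - 1) * (P.L : ℝ) ^ k) * P.d * Tu ^ 2 + 2 * δ ^ 2 ≤ 1 / 2 →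
      ∀ (θ : ℝ), 0 ≤ θ → θ ≤ 1 →
      ∀ (x₁ x₂ : Balaban1983to89.Site P 0) (n : ℕ) (sq : ℕ → Balaban1983to89.Site P 0) (cb : ℕ → PBond P 0),
        sq 0 = x₁ → sq n = x₂ → (∀ m < n, Joins (cb m) (sq m) (sq (m + 1))) →
        (n : ℝ) ≤ ((d : ℝ) + 1) * B5Ineq137Torus.T P 0 x₁ x₂ →
        (∀ m ≤ n, sq m ∈ (cubeT hPd (P.L ^ k) c fun i => P.L ^ k * M0 i) ∧
          (∀ i, R₀ ≤ (boxCoord hPd (P.L ^ k) c (sq m) i : ℝ) ∧ (boxCoord hPd (P.L ^ k) c (sq m) i : ℝ) + R₀ ≤ (P.L ^ k * M0 i : ℕ) - 1) ∧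
          B5Ineq137Torus.T P 0 x₁ (sq m) ≤ B5Ineq137Torus.T P 0 x₁ x₂) →
      ∀ (y : Balaban1983to89.Site P 0) (D : ℝ), 0 ≤ D → D ≤ B5Ineq137Torus.T P 0 x₁ y → D ≤ B5Ineq137Torus.T P 0 x₂ y →
        ((P.L : ℝ) ^ k / B5Ineq137Torus.T P 0 x₁ x₂) ^ θ *
          ‖toC (chainHol sq cb U n) *
              gLocT (B1RG242Torus.α P a k * (P.L : ℝ) ^ (k * P.d)) P.eps⁻¹ U k (cubeFam hPd (P.L ^ k) c M0 s W)
                (lamFam hPd (P.L ^ k) c M0 s) (cutoff R₁ R₀ (B5Ineq137Torus.T P 0)) x₂ y -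
            gLocT (B1RG242Torus.α P a k * (P.L : ℝ) ^ (k * P.d)) P.eps⁻¹ U k (cubeFam hPd (P.L ^ k) c M0 s W)
                (lamFam hPd (P.L ^ k) c M0 s) (cutoff R₁ R₀ (B5Ineq137Torus.T P 0)) x₁ y‖ ≤
          P.spacing k ^ 2 * (C * (1 + (⌊(((P.L : ℝ) ^ k) - 1 + R₀) / s⌋₊ + 3) ^ (d + 1) *
            ((P.L : ℝ) ^ k * ((R₀ - R₁)⁻¹ + (s : ℝ)⁻¹))) * Real.exp (-(t₀ * (((P.L : ℝ) ^ k)⁻¹ * D)))) := by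
  obtain ⟨K, hK0, hK⟩ := exists_abs_cutoff_sub_le.{0, 0}
  obtain ⟨t₀, C, ht₀, hC, H⟩ := holder230_smallField_of_lipschitz d ha hK0
  refine ⟨t₀, C, ht₀, hC, ?_⟩
  intro P hPd k hk1 hk c M0 hM0 hfit0 hN0 s W hs R R₀ R₁ hR hR₁ hR10 hW hgap U Tu δ hInt hTree hsmall θ hθ0 hθ1 x₁ x₂ n sq cb
    hsq0 hsqn hJ hnle hchain y D hD hD₁ hD₂
  obtain ⟨h1, h2, h3⟩ := cutoff_hyps (hK R₁ R₀ hR10 (B5Ineq137Torus.T P 0)) hK0 hR10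
  exact H P hPd k hk1 hk c M0 hM0 hfit0 hN0 s W hs R R₀ R₁ hR hR₁ hR10 hW hgap _ h1 h2 h3 U Tu δ hInt hTree hsmall θ hθ0 hθ1 x₁ x₂ n sq cb
    hsq0 hsqn hJ hnle hchain y D hD hD₁ hD₂

/-- **THE HÖLDER MEMBER OF ORDER `θ ≤ 1` FOR THE SMOOTH PRODUCT CUT-OFF `ζ″ = ζ^Π(R₁, R₀)`** at non-flat small fields, kernel form, along every
admissible contour. [cite: BalabanImbrieJaffe1988, (2.30) p.263] -/
theorem holder230_smallField_zetaPi (d : ℕ) {a : ℝ} (ha : 0 < a) :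
    ∃ t₀ C : ℝ, 0 < t₀ ∧ 0 < C ∧ ∀ (P : Params) (hPd : P.d = d + 1),
      ∀ k : ℕ, 1 ≤ k → k ≤ P.m + P.K → ∀ (c M0 : Fin (d + 1) → ℕ), (∀ i, 1 ≤ M0 i) →
        (∀ i, c i * P.L ^ k + P.L ^ k * M0 i ≤ P.sitesPerDir 0) → (∀ i, P.L ^ k * M0 i < P.sitesPerDir 0) →
      ∀ (s W : ℕ), 1 ≤ s → ∀ (R R₀ R₁ : ℝ), 1 < R → 0 ≤ R₁ → R₁ < R₀ → 2 * (s : ℝ) / 3 + R₀ / 2 + R ≤ W →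
        (∀ i, ((P.L ^ k * M0 i : ℕ) : ℝ) + R ≤ P.sitesPerDir 0) →
      ∀ (U : GaugeField P 0 U1) (Tu δ : ℝ),
        (∀ b ∈ starB (cubeT hPd (P.L ^ k) c fun i => P.L ^ k * M0 i), blkIter k b.src = blkIter k b.tgt → ‖toC (U b) - 1‖ ≤ Tu) →
        (∀ x ∈ (cubeT hPd (P.L ^ k) c fun i => P.L ^ k * M0 i), ‖holCK U k x - 1‖ ≤ δ) →
        2 * (((P.L : ℝ) ^ k - 1) * (P.L : ℝ) ^ k) * P.d * Tu ^ 2 + 2 * δ ^ 2 ≤ 1 / 2 →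
      ∀ (θ : ℝ), 0 ≤ θ → θ ≤ 1 →
      ∀ (x₁ x₂ : Balaban1983to89.Site P 0) (n : ℕ) (sq : ℕ → Balaban1983to89.Site P 0) (cb : ℕ → PBond P 0),
        sq 0 = x₁ → sq n = x₂ → (∀ m < n, Joins (cb m) (sq m) (sq (m + 1))) →
        (n : ℝ) ≤ ((d : ℝ) + 1) * B5Ineq137Torus.T P 0 x₁ x₂ →
        (∀ m ≤ n, sq m ∈ (cubeT hPd (P.L ^ k) c fun i => P.L ^ k * M0 i) ∧
          (∀ i, R₀ ≤ (boxCoord hPd (P.L ^ k) c (sq m) i : ℝ) ∧ (boxCoord hPd (P.L ^ k) c (sq m) i : ℝ) + R₀ ≤ (P.L ^ k * M0 i : ℕ) - 1) ∧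
          B5Ineq137Torus.T P 0 x₁ (sq m) ≤ B5Ineq137Torus.T P 0 x₁ x₂) →
      ∀ (y : Balaban1983to89.Site P 0) (D : ℝ), 0 ≤ D → D ≤ B5Ineq137Torus.T P 0 x₁ y → D ≤ B5Ineq137Torus.T P 0 x₂ y →
        ((P.L : ℝ) ^ k / B5Ineq137Torus.T P 0 x₁ x₂) ^ θ *
          ‖toC (chainHol sq cb U n) *
              gLocT (B1RG242Torus.α P a k * (P.L : ℝ) ^ (k * P.d)) P.eps⁻¹ U k (cubeFam hPd (P.L ^ k) c M0 s W)
                (lamFam hPd (P.L ^ k) c M0 s) (zetaPi R₁ R₀ 0) x₂ y -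
            gLocT (B1RG242Torus.α P a k * (P.L : ℝ) ^ (k * P.d)) P.eps⁻¹ U k (cubeFam hPd (P.L ^ k) c M0 s W)
                (lamFam hPd (P.L ^ k) c M0 s) (zetaPi R₁ R₀ 0) x₁ y‖ ≤
          P.spacing k ^ 2 * (C * (1 + (⌊(((P.L : ℝ) ^ k) - 1 + R₀) / s⌋₊ + 3) ^ (d + 1) *
            ((P.L : ℝ) ^ k * ((R₀ - R₁)⁻¹ + (s : ℝ)⁻¹))) * Real.exp (-(t₀ * (((P.L : ℝ) ^ k)⁻¹ * D)))) := by
  obtain ⟨Cσ, hC0, hC1, -⟩ := exists_abs_deriv_and_deriv_deriv_smoothTransition_le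
  obtain ⟨t₀, C, ht₀, hC, H⟩ := holder230_smallField_of_lipschitz d ha hC0
  refine ⟨t₀, C, ht₀, hC, ?_⟩
  intro P hPd k hk1 hk c M0 hM0 hfit0 hN0 s W hs R R₀ R₁ hR hR₁ hR10 hW hgap U Tu δ hInt hTree hsmall θ hθ0 hθ1 x₁ x₂ n sq cb
    hsq0 hsqn hJ hnle hchain y D hD hD₁ hD₂
  exact H P hPd k hk1 hk c M0 hM0 hfit0 hN0 s W hs R R₀ R₁ hR hR₁ hR10 hW hgap _ (abs_zetaPi_zero_le_one R₁ R₀)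
    (zetaPi_zero_eq_zero_of_le hR10) (abs_zetaPi_zero_shift_sub_le hC1 hR10) U Tu δ hInt hTree hsmall θ hθ0 hθ1 x₁ x₂ n sq cb
    hsq0 hsqn hJ hnle hchain y D hD hD₁ hD₂

end Instances

/-! ## §6 Admissible contours exist: the chart staircase between two deep points of `Ω₀` ([6]'s *"shortest contour"*) -/

section Staircase

open BIJ88NeumannPropagatorFlatDecayCube
open BIJ88LocWeights227Torus
open B4Reflection242 (boxDom mem_boxDom)
open B4ContourShift (supNorm abs_le_supNorm supNorm_nonneg exists_supNorm_eq)

variable {d : ℕ} (hPd : P.d = d + 1) {n : ℕ} {c : Fin (d + 1) → ℕ}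

/-- **A STAIRCASE IN THE CHART** (one coordinate step at a time toward the end point; [6] p. 573 *"Γ_{x,x′} a shortest contour connecting
these points"*): from every point `z` of the coordinate hull of `z₁, z₂` there is a bond chain on the torus from `cubePt z` to `cubePt z₂` of
exactly `Σ_j|z₂ j − z j|` steps, all of whose sites are chart points of the hull. [cite: Balaban1983RegularityDecay, (1.9) p.573] -/
theorem exists_staircase (z₁ z₂ : Fin (d + 1) → ℤ) :
    ∀ (N : ℕ) (z : Fin (d + 1) → ℤ), (∀ j, min (z₁ j) (z₂ j) ≤ z j ∧ z j ≤ max (z₁ j) (z₂ j)) → ∑ j, (z₂ j - z j).natAbs = N →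
      ∃ (sq : ℕ → Balaban1983to89.Site P 0) (cb : ℕ → PBond P 0), sq 0 = cubePt hPd n c z ∧ sq N = cubePt hPd n c z₂ ∧
        (∀ m < N, Joins (cb m) (sq m) (sq (m + 1))) ∧
        (∀ m ≤ N, ∃ w : Fin (d + 1) → ℤ, (∀ j, min (z₁ j) (z₂ j) ≤ w j ∧ w j ≤ max (z₁ j) (z₂ j)) ∧ sq m = cubePt hPd n c w) := by
  intro N
  induction N with
  | zero =>
      intro z hz hsum
      have hzz : z = z₂ := by
        funext j
        have h := (Finset.sum_eq_zero_iff.1 hsum) j (Finset.mem_univ j)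
        omega
      subst hzz
      refine ⟨fun _ => cubePt hPd n c z, fun _ => ⟨cubePt hPd n c z, Fin.cast hPd.symm 0⟩, rfl, rfl, fun m hm => absurd hm (Nat.not_lt_zero m),
        fun m _ => ⟨z, hz, rfl⟩⟩
  | succ N ih =>
      intro z hz hsum
      -- a coordinate in which `z` differs from `z₂`
      obtain ⟨i, hi⟩ : ∃ i, z i ≠ z₂ i := by
        by_contra h
        push Not at h
        have : ∑ j, (z₂ j - z j).natAbs = 0 := Finset.sum_eq_zero fun j _ => by rw [← h j, sub_self, Int.natAbs_zero]
        omega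
      -- one step toward `z₂` in that coordinate
      set σ : ℤ := if z i < z₂ i then 1 else -1 with hσdef
      set z' : Fin (d + 1) → ℤ := z + Pi.single i σ with hz'def
      have hz'i : z' i = z i + σ := by rw [hz'def, Pi.add_apply, Pi.single_eq_same]
      have hz'j : ∀ j, j ≠ i → z' j = z j := fun j hj => by rw [hz'def, Pi.add_apply, Pi.single_eq_of_ne hj, add_zero]
      have hz'hull : ∀ j, min (z₁ j) (z₂ j) ≤ z' j ∧ z' j ≤ max (z₁ j) (z₂ j) := by
        intro j
        by_cases hji : j = i
        · subst hji
          rw [hz'i, hσdef]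
          have h1 := hz j
          have h2 := min_le_right (z₁ j) (z₂ j)
          have h3 := le_max_right (z₁ j) (z₂ j)
          split_ifs with hlt
          · constructor <;> omega
          · constructor <;> omega
        · rw [hz'j j hji]; exact hz j
      have hsum' : ∑ j, (z₂ j - z' j).natAbs = N := by
        have hsplit := Finset.sum_erase_add Finset.univ (fun j => (z₂ j - z j).natAbs) (Finset.mem_univ i)
        have hsplit' := Finset.sum_erase_add Finset.univ (fun j => (z₂ j - z' j).natAbs) (Finset.mem_univ i)
        have hrest : ∑ j ∈ Finset.univ.erase i, (z₂ j - z' j).natAbs = ∑ j ∈ Finset.univ.erase i, (z₂ j - z j).natAbs :=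
          Finset.sum_congr rfl fun j hj => by rw [hz'j j (Finset.ne_of_mem_erase hj)]
        have hstep : (z₂ i - z' i).natAbs + 1 = (z₂ i - z i).natAbs := by
          rw [hz'i, hσdef]
          split_ifs with hlt <;> omega
        omega
      obtain ⟨sq', cb', h0', hN', hJ', hhull'⟩ := ih z' hz'hull hsum'
      -- the first bond: between `cubePt z` and `cubePt z'`
      set μ : Fin P.d := Fin.cast hPd.symm i with hμdef
      set b₀ : PBond P 0 := if z i < z₂ i then ⟨cubePt hPd n c z, μ⟩ else ⟨cubePt hPd n c z', μ⟩ with hb₀def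
      have hJ0 : Joins b₀ (cubePt hPd n c z) (cubePt hPd n c z') := by
        rw [hb₀def]
        split_ifs with hlt
        · left
          refine ⟨rfl, ?_⟩
          show (cubePt hPd n c z).shift μ = cubePt hPd n c z'
          rw [hz'def, hσdef, if_pos hlt, cubePt_add_single]
        · right
          refine ⟨rfl, ?_⟩
          show (cubePt hPd n c z').shift μ = cubePt hPd n c z
          have e : z = z' + Pi.single i 1 := by
            rw [hz'def, hσdef, if_neg hlt, add_assoc, ← Pi.single_add, neg_add_cancel, Pi.single_zero, add_zero]
          rw [e, cubePt_add_single]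
      refine ⟨fun m => if m = 0 then cubePt hPd n c z else sq' (m - 1), fun m => if m = 0 then b₀ else cb' (m - 1), by simp, ?_, ?_, ?_⟩
      · simp only [Nat.succ_ne_zero, if_false, Nat.add_sub_cancel]; exact hN'
      · intro m hm
        rcases Nat.eq_zero_or_pos m with rfl | hpos
        · simp only [if_true, Nat.zero_add, Nat.one_ne_zero, if_false, Nat.sub_self]
          rw [h0']; exact hJ0
        · have e1 : (if m = 0 then cubePt hPd n c z else sq' (m - 1)) = sq' (m - 1) := if_neg hpos.ne'
          have e2 : (if m + 1 = 0 then cubePt hPd n c z else sq' (m + 1 - 1)) = sq' (m - 1 + 1) := by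
            rw [if_neg (Nat.succ_ne_zero m)]; congr 1; omega
          have e3 : (if m = 0 then b₀ else cb' (m - 1)) = cb' (m - 1) := if_neg hpos.ne'
          dsimp only
          rw [e1, e2, e3]
          exact hJ' (m - 1) (by omega)
      · intro m hm
        rcases Nat.eq_zero_or_pos m with rfl | hpos
        · exact ⟨z, hz, by simp⟩
        · obtain ⟨w, hw, hw'⟩ := hhull' (m - 1) (by omega)
          exact ⟨w, hw, by dsimp only; rw [if_neg hpos.ne']; exact hw'⟩

/-- **ADMISSIBLE CONTOURS EXIST BETWEEN NEAR DEEP POINTS** (the contour hypothesis of `holder230_smallField_of_lipschitz` is met by the chart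
staircase): for `x₁, x₂` in the no-wrap box `Ω₀ = c·n + Π_i[0, n·M₀_i)` with `x₁` at chart depth `≥ R₀`, `x₂` at chart depth `≥ R₀′` and
`|x₁ − x₂|_T ≤ R₀` (so that torus-close means chart-close, gen 26's `mem_and_abs_sub_le_of_T_le`), there is a bond chain from `x₁` to `x₂` of
`n ≤ (d+1)|x₁ − x₂|_T` steps whose sites lie in `Ω₀` at chart depth `≥ min(R₀, R₀′)` coordinatewise between the end points, each within
sup-torus distance `|x₁ − x₂|_T` of `x₁` — [6]'s *"Γ_{x,x′} a shortest contour connecting these points"* realised on the torus of record.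
[cite: Balaban1983RegularityDecay, (1.9) p.573] -/
theorem exists_admissible_contour {M0 : Fin (d + 1) → ℕ} (hfit : ∀ i, c i * n + n * M0 i ≤ P.sitesPerDir 0) {R₀ R₀' : ℝ}
    {x₁ x₂ : Balaban1983to89.Site P 0} (hx₁ : x₁ ∈ (cubeT hPd n c fun i => n * M0 i))
    (hdeep₁ : ∀ i, R₀ ≤ (boxCoord hPd n c x₁ i : ℝ) ∧ (boxCoord hPd n c x₁ i : ℝ) + R₀ ≤ (n * M0 i : ℕ) - 1)
    (hx₂ : x₂ ∈ (cubeT hPd n c fun i => n * M0 i))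
    (hdeep₂ : ∀ i, R₀' ≤ (boxCoord hPd n c x₂ i : ℝ) ∧ (boxCoord hPd n c x₂ i : ℝ) + R₀' ≤ (n * M0 i : ℕ) - 1)
    (hT : B5Ineq137Torus.T P 0 x₁ x₂ ≤ R₀) :
    ∃ (N : ℕ) (sq : ℕ → Balaban1983to89.Site P 0) (cb : ℕ → PBond P 0), sq 0 = x₁ ∧ sq N = x₂ ∧
      (∀ m < N, Joins (cb m) (sq m) (sq (m + 1))) ∧ (N : ℝ) ≤ ((d : ℝ) + 1) * B5Ineq137Torus.T P 0 x₁ x₂ ∧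
      ∀ m ≤ N, sq m ∈ (cubeT hPd n c fun i => n * M0 i) ∧
        (∀ i, min R₀ R₀' ≤ (boxCoord hPd n c (sq m) i : ℝ) ∧ (boxCoord hPd n c (sq m) i : ℝ) + min R₀ R₀' ≤ (n * M0 i : ℕ) - 1) ∧
        B5Ineq137Torus.T P 0 x₁ (sq m) ≤ B5Ineq137Torus.T P 0 x₁ x₂ := by
  obtain ⟨hz₁, hxz₁⟩ := cubePt_boxCoord hPd hfit hx₁
  obtain ⟨hz₂, hxz₂⟩ := cubePt_boxCoord hPd hfit hx₂
  set z₁ := boxCoord hPd n c x₁ with hz₁def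
  set z₂ := boxCoord hPd n c x₂ with hz₂def
  set T12 : ℝ := B5Ineq137Torus.T P 0 x₁ x₂ with hT12def
  -- torus-close and deep ⇒ chart-close
  have hdeepT : ∀ i, T12 ≤ (z₁ i : ℝ) ∧ (z₁ i : ℝ) + T12 ≤ (n * M0 i : ℕ) - 1 := fun i => by
    have h1 := hdeep₁ i
    constructor <;> linarith [h1.1, h1.2]
  have hclose : ∀ i, ((|z₁ i - z₂ i| : ℤ) : ℝ) ≤ T12 := (mem_and_abs_sub_le_of_T_le hPd hfit hdeepT le_rfl).2
  -- hull points: in the box, deep, chart-close to `z₁`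
  have hullDom : ∀ z : Fin (d + 1) → ℤ, (∀ j, min (z₁ j) (z₂ j) ≤ z j ∧ z j ≤ max (z₁ j) (z₂ j)) → z ∈ boxDom (fun i => n * M0 i) := by
    intro z hz
    rw [mem_boxDom]
    intro i
    have h1 := (mem_boxDom.1 hz₁) i; have h2 := (mem_boxDom.1 hz₂) i; have h3 := hz i
    constructor <;> omega
  have hullDeep : ∀ z : Fin (d + 1) → ℤ, (∀ j, min (z₁ j) (z₂ j) ≤ z j ∧ z j ≤ max (z₁ j) (z₂ j)) →
      ∀ i, min R₀ R₀' ≤ (boxCoord hPd n c (cubePt hPd n c z) i : ℝ) ∧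
        (boxCoord hPd n c (cubePt hPd n c z) i : ℝ) + min R₀ R₀' ≤ (n * M0 i : ℕ) - 1 := by
    intro z hz i
    rw [boxCoord_cubePt hPd hfit (hullDom z hz)]
    have h1 := hdeep₁ i; have h2 := hdeep₂ i; have h3 := hz i
    have hm1 : min R₀ R₀' ≤ R₀ := min_le_left _ _
    have hm2 : min R₀ R₀' ≤ R₀' := min_le_right _ _
    rcases le_total (z₁ i) (z₂ i) with h12 | h12
    · rw [min_eq_left h12, max_eq_right h12] at h3
      have h4 : (z₁ i : ℝ) ≤ z i := by exact_mod_cast h3.1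
      have h5 : (z i : ℝ) ≤ z₂ i := by exact_mod_cast h3.2
      constructor <;> linarith [h1.1, h2.2]
    · rw [min_eq_right h12, max_eq_left h12] at h3
      have h4 : (z₂ i : ℝ) ≤ z i := by exact_mod_cast h3.1
      have h5 : (z i : ℝ) ≤ z₁ i := by exact_mod_cast h3.2
      constructor <;> linarith [h2.1, h1.2]
  have hullClose : ∀ z : Fin (d + 1) → ℤ, (∀ j, min (z₁ j) (z₂ j) ≤ z j ∧ z j ≤ max (z₁ j) (z₂ j)) → supNorm (z₁ - z) ≤ T12 := by
    intro z hz
    obtain ⟨i, hi'⟩ := exists_supNorm_eq (z₁ - z)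
    rw [hi', Pi.sub_apply]
    refine le_trans ?_ (hclose i)
    have h3 := hz i
    have key : |z₁ i - z i| ≤ |z₁ i - z₂ i| := by
      rw [abs_le]
      rcases le_total (z₁ i) (z₂ i) with h12 | h12
      · rw [min_eq_left h12, max_eq_right h12] at h3
        rw [abs_of_nonpos (by omega : z₁ i - z₂ i ≤ 0)]
        constructor <;> omega
      · rw [min_eq_right h12, max_eq_left h12] at h3
        rw [abs_of_nonneg (by omega : 0 ≤ z₁ i - z₂ i)]
        constructor <;> omega
    exact_mod_cast key
  -- the staircase from `z₁`
  set N : ℕ := ∑ j, (z₂ j - z₁ j).natAbs with hNdef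
  have hz₁hull : ∀ j, min (z₁ j) (z₂ j) ≤ z₁ j ∧ z₁ j ≤ max (z₁ j) (z₂ j) := fun j => ⟨min_le_left _ _, le_max_left _ _⟩
  obtain ⟨sq, cb, h0, hN, hJ, hhull⟩ := exists_staircase hPd (n := n) (c := c) z₁ z₂ N z₁ hz₁hull rfl
  refine ⟨N, sq, cb, by rw [h0, hxz₁], by rw [hN, hxz₂], hJ, ?_, fun m hm => ?_⟩
  · -- `N = ‖z₂ − z₁‖₁ ≤ (d+1)·T12`
    have h1 : ∀ j, (((z₂ j - z₁ j).natAbs : ℕ) : ℝ) ≤ T12 := fun j => by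
      have e : (((z₂ j - z₁ j).natAbs : ℕ) : ℝ) = ((|z₁ j - z₂ j| : ℤ) : ℝ) := by
        rw [Nat.cast_natAbs, abs_sub_comm]
      rw [e]; exact hclose j
    calc (N : ℝ) = ∑ j, (((z₂ j - z₁ j).natAbs : ℕ) : ℝ) := by rw [hNdef]; push_cast; rfl
      _ ≤ ∑ _j : Fin (d + 1), T12 := Finset.sum_le_sum fun j _ => h1 j
      _ = ((d : ℝ) + 1) * T12 := by rw [Finset.sum_const, Finset.card_univ, Fintype.card_fin, nsmul_eq_mul]; push_cast; ring
  · obtain ⟨w, hw, hsw⟩ := hhull m hm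
    rw [hsw]
    refine ⟨cubePt_mem_cubeT hPd (hullDom w hw), hullDeep w hw, ?_⟩
    have h4 := T_cubePt_le hPd hfit hz₁ (hullDom w hw)
    rw [hxz₁] at h4
    exact h4.trans (hullClose w hw)

end Staircase

/-! ## §7 The Hölder member along the chart staircase: [6]'s *"shortest contour Γ_{x,x′}"* form for near deep pairs -/

section ShortestContour

open BIJ88NeumannPropagatorFlatDecayCube
open BIJ88LocWeights227Torus
open BIJ88Cutoffs21 (cutoff)

variable {d : ℕ}

/-- **THE HÖLDER MEMBER OF ORDER `θ ≤ 1` OF (2.30) AT NON-FLAT SMALL FIELDS ALONG A SHORTEST CONTOUR, FOR THE PRINTED DATA** ([6] (1.9)'s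
form: *"|x − x′|^{−α}|U(A(Γ_{x,x′}))(…)(x′) − (…)(x)| ≤ … Here Γ_{x,x′} denotes a shortest contour connecting the points x, x′"*): with the
constants `t₀, C` of `holder230_smallField_cwt`, for every pair `x₁, x₂ ∈ Ω₀` at chart depth `≥ R₀` with `|x₁ − x₂|_T ≤ R₀` THERE IS a bond
chain `Γ` from `x₁` to `x₂` of `≤ (d+1)|x₁ − x₂|_T` steps (the chart staircase of §6) along which, for every column `y` at sup-torus distance
`≥ D ≥ 0` from both points, `(L^k/|x₁ − x₂|_T)^θ·‖u(Γ)G_{k,loc}(u; x₂, y) − G_{k,loc}(u; x₁, y)‖ ≤ (L^kε)²·C·(1 + m·L^k((R₀ − R₁)⁻¹ +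
s⁻¹))·e^{−t₀D/L^k}`. [cite: BalabanImbrieJaffe1988, (2.30) p.263] -/
theorem exists_contour_holder230_smallField_cwt (d : ℕ) {a : ℝ} (ha : 0 < a) :
    ∃ t₀ C : ℝ, 0 < t₀ ∧ 0 < C ∧ ∀ (P : Params) (hPd : P.d = d + 1),
      ∀ k : ℕ, 1 ≤ k → k ≤ P.m + P.K → ∀ (c M0 : Fin (d + 1) → ℕ), (∀ i, 1 ≤ M0 i) →
        (∀ i, c i * P.L ^ k + P.L ^ k * M0 i ≤ P.sitesPerDir 0) → (∀ i, P.L ^ k * M0 i < P.sitesPerDir 0) →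
      ∀ (s W : ℕ), 1 ≤ s → ∀ (R R₀ R₁ : ℝ), 1 < R → 0 ≤ R₁ → R₁ < R₀ → 2 * (s : ℝ) / 3 + R₀ / 2 + R ≤ W →
        (∀ i, ((P.L ^ k * M0 i : ℕ) : ℝ) + R ≤ P.sitesPerDir 0) →
      ∀ (U : GaugeField P 0 U1) (Tu δ : ℝ),
        (∀ b ∈ starB (cubeT hPd (P.L ^ k) c fun i => P.L ^ k * M0 i), blkIter k b.src = blkIter k b.tgt → ‖toC (U b) - 1‖ ≤ Tu) →
        (∀ x ∈ (cubeT hPd (P.L ^ k) c fun i => P.L ^ k * M0 i), ‖holCK U k x - 1‖ ≤ δ) →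
        2 * (((P.L : ℝ) ^ k - 1) * (P.L : ℝ) ^ k) * P.d * Tu ^ 2 + 2 * δ ^ 2 ≤ 1 / 2 →
      ∀ (θ : ℝ), 0 ≤ θ → θ ≤ 1 →
      ∀ (x₁ x₂ : Balaban1983to89.Site P 0),
        x₁ ∈ (cubeT hPd (P.L ^ k) c fun i => P.L ^ k * M0 i) →
        (∀ i, R₀ ≤ (boxCoord hPd (P.L ^ k) c x₁ i : ℝ) ∧ (boxCoord hPd (P.L ^ k) c x₁ i : ℝ) + R₀ ≤ (P.L ^ k * M0 i : ℕ) - 1) →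
        x₂ ∈ (cubeT hPd (P.L ^ k) c fun i => P.L ^ k * M0 i) →
        (∀ i, R₀ ≤ (boxCoord hPd (P.L ^ k) c x₂ i : ℝ) ∧ (boxCoord hPd (P.L ^ k) c x₂ i : ℝ) + R₀ ≤ (P.L ^ k * M0 i : ℕ) - 1) →
        B5Ineq137Torus.T P 0 x₁ x₂ ≤ R₀ →
      ∃ (N : ℕ) (sq : ℕ → Balaban1983to89.Site P 0) (cb : ℕ → PBond P 0), sq 0 = x₁ ∧ sq N = x₂ ∧
        (∀ m < N, Joins (cb m) (sq m) (sq (m + 1))) ∧ (N : ℝ) ≤ ((d : ℝ) + 1) * B5Ineq137Torus.T P 0 x₁ x₂ ∧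
      ∀ (y : Balaban1983to89.Site P 0) (D : ℝ), 0 ≤ D → D ≤ B5Ineq137Torus.T P 0 x₁ y → D ≤ B5Ineq137Torus.T P 0 x₂ y →
        ((P.L : ℝ) ^ k / B5Ineq137Torus.T P 0 x₁ x₂) ^ θ *
          ‖toC (chainHol sq cb U N) *
              gLocT (B1RG242Torus.α P a k * (P.L : ℝ) ^ (k * P.d)) P.eps⁻¹ U k (cubeFam hPd (P.L ^ k) c M0 s W)
                (lamFam hPd (P.L ^ k) c M0 s) (cutoff R₁ R₀ (B5Ineq137Torus.T P 0)) x₂ y -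
            gLocT (B1RG242Torus.α P a k * (P.L : ℝ) ^ (k * P.d)) P.eps⁻¹ U k (cubeFam hPd (P.L ^ k) c M0 s W)
                (lamFam hPd (P.L ^ k) c M0 s) (cutoff R₁ R₀ (B5Ineq137Torus.T P 0)) x₁ y‖ ≤
          P.spacing k ^ 2 * (C * (1 + (⌊(((P.L : ℝ) ^ k) - 1 + R₀) / s⌋₊ + 3) ^ (d + 1) *
            ((P.L : ℝ) ^ k * ((R₀ - R₁)⁻¹ + (s : ℝ)⁻¹))) * Real.exp (-(t₀ * (((P.L : ℝ) ^ k)⁻¹ * D)))) := by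
  obtain ⟨t₀, C, ht₀, hC, H⟩ := holder230_smallField_cwt d ha
  refine ⟨t₀, C, ht₀, hC, ?_⟩
  intro P hPd k hk1 hk c M0 hM0 hfit0 hN0 s W hs R R₀ R₁ hR hR₁ hR10 hW hgap U Tu δ hInt hTree hsmall θ hθ0 hθ1 x₁ x₂ hx₁ hdeep₁ hx₂
    hdeep₂ hT
  obtain ⟨N, sq, cb, h0, hN, hJ, hNle, hchain⟩ := exists_admissible_contour hPd hfit0 hx₁ hdeep₁ hx₂ hdeep₂ hT
  refine ⟨N, sq, cb, h0, hN, hJ, hNle, fun y D hD hD₁ hD₂ => ?_⟩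
  have hchain' : ∀ m ≤ N, sq m ∈ (cubeT hPd (P.L ^ k) c fun i => P.L ^ k * M0 i) ∧
      (∀ i, R₀ ≤ (boxCoord hPd (P.L ^ k) c (sq m) i : ℝ) ∧ (boxCoord hPd (P.L ^ k) c (sq m) i : ℝ) + R₀ ≤ (P.L ^ k * M0 i : ℕ) - 1) ∧
      B5Ineq137Torus.T P 0 x₁ (sq m) ≤ B5Ineq137Torus.T P 0 x₁ x₂ := fun m hm => by
    obtain ⟨h1, h2, h3⟩ := hchain m hm
    exact ⟨h1, fun i => by simpa only [min_self] using h2 i, h3⟩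
  exact H P hPd k hk1 hk c M0 hM0 hfit0 hN0 s W hs R R₀ R₁ hR hR₁ hR10 hW hgap U Tu δ hInt hTree hsmall θ hθ0 hθ1 x₁ x₂ N sq cb h0 hN hJ
    hNle hchain' y D hD hD₁ hD₂

end ShortestContour

/-! ## §8 Non-vacuity: every hypothesis of `deriv230_smallField_cwt` met at once on a genuine `Setup.Params` torus -/

section Instance

open BIJ88NeumannPropagatorFlatDecayCube
open BIJ88NeumannPropagatorFlatDecay (holCK_flat)
open BIJ88LocWeights227Torus
open BIJ88Cutoffs21 (cutoff)
open B4Reflection242 (boxDom mem_boxDom)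

/-- The parameters of the instance (gen 26's §6 torus): `d = 1`, `L = 3`, `m = 1`, `K = 3` — `2·3⁴ = 162` fine sites. [cite: Balaban1987RG1, (0.1) p.251] -/
private abbrev P3 : Params := { d := 1, L := 3, m := 1, K := 3, hd := le_rfl, hL := ⟨⟨1, rfl⟩, by norm_num⟩ }

/-- `|T^{(0)}| = 162`. [cite: Balaban1987RG1, (0.1) p.251] -/
private theorem sites_P3 : P3.sitesPerDir 0 = 162 := by decide

/-- **THE HYPOTHESES OF `deriv230_smallField_cwt` ARE JOINTLY SATISFIABLE** (the member is not a statement about the empty set): on the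
`Setup` torus `ℤ/162` (`d = 1`, `L = 3`), at `k = 1`, box `Ω₀ = [0, 12)` (`c = 0`, `M₀ = 4`), cube spacing `s = 1`, half-width `W = 4`, radii
`R = 2`, `R₁ = 0`, `R₀ = 1`, the trivial field `u = 1` (bondwise small with `T = δ = 0`: p31's `holCK_flat`) and the bond `⟨5, 6⟩` (both ends
at chart depth `≥ 1`), every displayed hypothesis holds; consequently the covariant-derivative bound applies there for every column `y` with the
block count `(⌊(3 − 1 + 1)/1⌋ + 3)^1 = 6`. [cite: BalabanImbrieJaffe1988, (2.30) p.263] -/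
theorem deriv230_smallField_cwt_instance :
    ∃ t₀ C : ℝ, 0 < t₀ ∧ 0 < C ∧ ∀ y : Balaban1983to89.Site P3 0,
      ‖covD P3.eps⁻¹ (cfg (1 : GaugeField P3 0 U1)) (fun z =>
          gLocT (B1RG242Torus.α P3 1 1 * (P3.L : ℝ) ^ (1 * P3.d)) P3.eps⁻¹ (1 : GaugeField P3 0 U1) 1
            (cubeFam (d := 0) rfl (P3.L ^ 1) (fun _ => 0) (fun _ => 4) 1 4) (lamFam (d := 0) rfl (P3.L ^ 1) (fun _ => 0) (fun _ => 4) 1)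
            (cutoff 0 1 (B5Ineq137Torus.T P3 0)) z y)
          ⟨cubePt (d := 0) rfl (P3.L ^ 1) (fun _ => 0) (fun _ => 5), Fin.cast (rfl : P3.d = 0 + 1).symm 0⟩‖ ≤
        P3.spacing 1 * (C * (1 + (⌊(((P3.L : ℝ) ^ 1) - 1 + 1) / (1 : ℕ)⌋₊ + 3) ^ (0 + 1) * ((P3.L : ℝ) ^ 1 * ((1 - 0 : ℝ)⁻¹ + ((1 : ℕ) : ℝ)⁻¹))) *
          Real.exp (-(t₀ * (((P3.L : ℝ) ^ 1)⁻¹ * B5Ineq137Torus.T P3 0 (cubePt (d := 0) rfl (P3.L ^ 1) (fun _ => 0) (fun _ => 5)) y)))) := by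
  obtain ⟨t₀, C, ht₀, hC, H⟩ := deriv230_smallField_cwt 0 one_pos
  refine ⟨t₀, C, ht₀, hC, fun y => ?_⟩
  have hfit : ∀ i : Fin (0 + 1), (fun _ => 0 : Fin (0 + 1) → ℕ) i * P3.L ^ 1 + P3.L ^ 1 * (fun _ => 4 : Fin (0 + 1) → ℕ) i ≤ P3.sitesPerDir 0 :=
    fun _ => by rw [sites_P3]; norm_num
  have hN0 : ∀ i : Fin (0 + 1), P3.L ^ 1 * (fun _ => 4 : Fin (0 + 1) → ℕ) i < P3.sitesPerDir 0 := fun _ => by rw [sites_P3]; norm_num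
  have hgap : ∀ i : Fin (0 + 1), ((P3.L ^ 1 * (fun _ => 4 : Fin (0 + 1) → ℕ) i : ℕ) : ℝ) + 2 ≤ P3.sitesPerDir 0 := fun _ => by
    rw [sites_P3]; norm_num
  -- the two bond ends in the chart
  have hz5 : (fun _ => (5 : ℤ) : Fin (0 + 1) → ℤ) ∈ boxDom (fun i : Fin (0 + 1) => P3.L ^ 1 * (fun _ => 4 : Fin (0 + 1) → ℕ) i) := by
    rw [mem_boxDom]; intro i; norm_num
  have hz6 : (fun _ => (6 : ℤ) : Fin (0 + 1) → ℤ) ∈ boxDom (fun i : Fin (0 + 1) => P3.L ^ 1 * (fun _ => 4 : Fin (0 + 1) → ℕ) i) := by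
    rw [mem_boxDom]; intro i; norm_num
  have hshift : (cubePt (d := 0) rfl (P3.L ^ 1) (fun _ => 0) (fun _ => 5)).shift (Fin.cast (rfl : P3.d = 0 + 1).symm 0) =
      cubePt (d := 0) rfl (P3.L ^ 1) (fun _ => 0) (fun _ => 6) := by
    rw [← cubePt_add_single]
    congr 1
    funext j
    fin_cases j
    simp
  refine H P3 rfl 1 le_rfl (by decide) (fun _ => 0) (fun _ => 4) (fun _ => by norm_num) hfit hN0 1 4 le_rfl 2 1 0 (by norm_num) le_rfl one_pos
    (by norm_num) hgap (1 : GaugeField P3 0 U1) 0 0 (fun b _ _ => ?_) (fun x _ => ?_) (by norm_num) _ _ (cubePt_mem_cubeT rfl hz5)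
    (fun i => ?_) ?_ (fun i => ?_) y
  · have : (1 : GaugeField P3 0 U1) b = 1 := rfl
    rw [this, toC_one, sub_self, norm_zero]
  · rw [holCK_flat (by decide) x, sub_self, norm_zero]
  · rw [boxCoord_cubePt rfl hfit hz5]; norm_num
  · rw [hshift]; exact cubePt_mem_cubeT rfl hz6
  · rw [hshift, boxCoord_cubePt rfl hfit hz6]; norm_num

end Instance

end

end Literature.MathematicalPhysics.QuantumFieldTheory.BalabanImbrieJaffe1984to88.BIJ88LocDeriv230SmallFieldTorus
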